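import Literature.Geometry.Lorentzian.Hintz2026.CarterTetradFrame

/-!
# Hintz 2026, (6.16c) `EqWGTrMarckNabla` = Hintz, *Gluing II*, Proposition 3.21: the pull-back connection
# `∇^{π*T*𝓜}_{H_{G_b}}` in the Marck-type frame `e⁰, e¹, e², e³` — the "lengthy direct computation", done in the kernel
# for ALL parameters `(𝔪, a)`, together with the Christoffel symbols of Kerr and the conservation of Carter's constant

#harness_tags [topic Geometry/Lorentzian]

CITATION HEADER (lean-in-tree rule 2026-08-18).  P. Hintz, *Nonlinear stability of subextremal Kerr black holes*,
arXiv:2606.28253 **v2** (2026-08-03), bib key `Hintz2026` — an UNREFEREED CLAIM under adjudication in this library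
(`Literature.Geometry.Lorentzian.hintz_kerr_stability_subextremal_cauchy` carries its main theorem as
`@[claim "Hintz2026" "under-review"]`); "H l.N" = line N of the v2 TeX source `kerr-stab-r.tex` (md5 2c6513182847).
P. Hintz, *Gluing small black holes along timelike geodesics II*, arXiv:2408.06712 (bib `Hintz2024GluingII`, "GII"; UNREFEREED
preprint; "GII l.N" = line N of its TeX source `glueloc2.tex`, md5 150225951188) is the source Hintz cites for (6.16c):
GII Proposition 3.21 `PropGlDynTrNabla`, whose proof ends "A lengthy direct computation gives `α₀ = 2σ`." (GII l.2960) — the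
computation is not printed in either paper.  The frame follows J.-A. Marck, Phys. Lett. A 97 (1983) 140–142 (bib `Marck1983`;
GII's [MarckParallelNull]); B. Carter, Comm. Math. Phys. 10 (1968) 280–310 (bib `Carter1968`, REFEREED) for the constant of
motion.  Written by the audit cell `pub-kerr` (HINTZ-PLAN.md P39; GAPS.md C-A23; it continues
`CarterTetradFrame`, module 67, which reproduces (6.15)/(6.16a) and says "(6.16c) — NOT reproduced here (it needs the
Levi-Civita connection)").  Nothing in this file is a stability statement, an estimate, or a statement about the trapped set
`Γ₀`: it is exact finite algebra and certified differentiation of printed closed-form expressions, valid for every real `𝔪`,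
`a` wherever the printed divisors are non-zero (`μ = r² − 2𝔪r + a² ≠ 0`: off the horizons; `P = r² + a²cos²θ ≠ 0`;
`S = sin²θ ≠ 0`: off the axis) — no smallness of `a`, no sub-extremality.

## What is printed

* H l.6009–6019 (v2 PDF p.115): "we recall from [GII, Proposition 3.21] that in the smooth bundle splitting (6.16b)
  `⟨𝖾⁰⟩ ⊕ ⟨𝖾¹⟩ ⊕ ⟨𝖾²⟩ ⊕ ⟨𝖾³⟩`, `𝖾^μ := 𝒞^{-1/2}e^μ`, of `π*T*𝓜_b` over the set `{𝒞 > 0}` … we have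
  (6.16c) `∇^{π*T*𝓜_b}_{H_{G_b}} = H_{G_b} + 2σ·[[0,1,0,0],[0,0,1,0],[0,0,0,0],[0,0,0,0]]`."  Here (H l.5981) "`σ = −⟨·,∂_𝔱⟩` is
  the (negative) time momentum in Boyer–Lindquist coordinates", covectors being written `−σ d𝔱 + ξ dr + η_θ dθ + η_ϕ dϕ`
  (H l.5988; GII Definition 3.12 `DefGlDynKerrTrap`, GII l.2723–2725), and `∇^{π*T*𝓜}` is the pull-back of the Levi-Civita
  connection (GII l.2852: "denote by `∇^{π*T*M̂_b°}` the pullback of the Levi-Civita connection on `(M̂_b°, ĝ_b)`. Write (3.x)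
  `𝒟_b := ∇^{π*T*M̂_b°}_{H_{Ĝ_b}} ∈ Diff¹(T*M̂_b°; π*T*M̂_b°)`").  The Hamiltonian vector field convention is GII's
  (EqGlDynKerrLocRestr), GII l.2679–2681: `H_p = (∂_ξ p)∂_x − (∂_x p)∂_ξ` (summed over conjugate pairs), under which (GII l.2864)
  "the pushforward of `H_{Ĝ_b}|_{(z,ζ)}` along `π` is twice the vector dual to `ζ`".
* GII Proposition 3.21 (l.2941–2952) is the same statement; its PROOF (l.2953–2963): `e⁰ = γ̇♭` is parallel, and `H𝒞 = 0`, so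
  `𝒟_b𝖾⁰ = 0`; "By the properties of `KY`, also `e³` and therefore `𝖾³` are parallel"; by Lemma 3.20 `𝒟_b𝖾¹ = α₀𝖾⁰` with
  `α₀ = −ĝ_b⁻¹(𝒟_b𝖾¹, 𝖾²)`, `𝒟_b𝖾² = β₁𝖾¹` with `β₁ = α₀`; "A lengthy direct computation gives `α₀ = 2σ`." (l.2960).
* H l.5988: the Carter constant "is conserved along the Hamiltonian flow of `G_b` in the characteristic set `G_b⁻¹(0)`, where
  `G_b(ζ) := g_b⁻¹(ζ,ζ)` is the dual metric function"; GII l.2883–2886: "`𝒞 = ϱ²(ω_(2)² + ω_(3)²) − a²cos²θ Ĝ_b` … is a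
  constant of motion, i.e. `H_{Ĝ_b}𝒞 = 0`. On the characteristic set, it is equal to `𝒞̃ = … = η_θ² + sin⁻²θ(η_ϕ − a sin²θ σ)²`".
* GII Remark 3.22 `RmkGlDynTrSchw` (l.2967–2977): at `a = 0`, `r = 3𝔪`, `ξ = 0`: "`e⁰ = −σ dt + η`, `e¹ = −9𝔪σ dr`,
  `e² = (9𝔪²/2)(σ dt + η)`, `e³ = 3𝔪(⋆η)`".
* The metric, the tetrad (6.15) and the frame `e^μ` (H l.3591–3592, l.5991–6002) are those transcribed in `KerrDualMetricForm`
  (`GBL`, `QBL`) and `CarterTetradFrame` (`e0 … e3`, `Jmat`, `Kmat`, `Nmat`, `carterC`); dictionaries are proved below.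

## Method: the chart `(𝔱, r, x = cos θ, ϕ)`

With `x = cos θ` (`dθ² = dx²/(1 − x²)`) every object is RATIONAL in `(r, x)`: the metric `gX` and dual metric `gXinv` (§1, with
`gX·gXinv = 1` and the dictionaries `gX = Λ·GBL·Λ`, `gXinv = ϱ⁻²Λ'·QBL·Λ'` to module 65), their `∂_r`, `∂_x` (§2), the
Christoffel symbols `Γ^l_{kn}` by the Koszul formula (§3; the twenty non-zero ones in closed form, `Gam_eq`), the dual metric
function `G_b(ζ) = ζ·g⁻¹·ζ`, its momentum gradient `Z^k = ∂G_b/∂ζ_k = 2(g⁻¹ζ)^k` and position gradient, the Hamiltonian vector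
field `H_{G_b} = Σ_k Z^k∂_{x^k} − (∂_{x^k}G_b)∂_{ζ_k}` and the pull-back connection
`(∇_{H_G}e)_ν = H_G(e_ν) − Γ^l_{κν}(π_*H_G)^κ e_l` on sections `e_ν = Σ_κ F_{νκ}(r,x)ζ_κ` linear in the momenta (§4), and the
frame `e^μ` itself, whose coframe components are linear in `ζ` with rational coefficients `F1, F2, F3` although the tetrad has
the square roots `√μ, ϱ, sin θ` (§5; checked against (6.16a) in `gram_xchart`).  DERIVATIVES ARE CERTIFIED, not assumed:
every `∂_r`/`∂_x`/`∂_{ζ_k}` value entering `Γ`, `H_G` and `∇` is an explicit closed form proposed by the cell's exact CAS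
(`code/adep1-g22/model.py`, stdlib rational functions) and PROVED to be the derivative by a `HasDerivAt` theorem assembled
from Mathlib's one-variable calculus (`hasDerivAt_gX_r`, …, `hasDerivAt_F3_x`, `hasDerivAt_Gb_mom`, `hasDerivAt_mulVec_update`,
`hasDerivAt_carterX_x/mom`); the identities themselves are decided by `field_simp`/`ring`.

## What is proved here (all real `𝔪, a, r, x`, `ζ`; only `P, μ, S ≠ 0` assumed)

1. (§3) `Gam_eq`: the Koszul formula from the certified `∂g` equals the closed-form table `GamC` of the twenty non-vanishing
   Kerr Christoffel symbols (`Γ^r_{𝔱𝔱} = 𝔪μ(r² − a²x²)/P³`, …), for all `(𝔪, a)`.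
2. (§5) `gram_xchart`: (6.16a) in coordinates, off shell: `g_b⁻¹(e^μ,e^ν) = 𝒞J_{μν} + G_bK_{μν}` with module 67's `J`, `K`
   (`c = a·x`) — so the coordinate frame `F1, F2, F3` is the printed one; `carterX_eq_carterC`: the x-chart `𝒞` is the printed `𝒞`.
3. (§6) **(6.16c) for all `(𝔪, a)`**: `nabla_e0`: `∇_{H_G}e⁰ = 0` and `nabla_e3`: `∇_{H_G}e³ = 0` IDENTICALLY (off shell too);
   `nabla_e1`: `∇_{H_G}e¹ = −2σe⁰ − 2G_b(∂_𝔱)♭`; `nabla_e2`: `∇_{H_G}e² = −2σe¹ + G_b(2r dr − 2a²x dx)`; hence `eq616c_onshell`: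
   on `G_b = 0`, `∇_{H_G}(e⁰,e¹,e²,e³) = (0, −2σe⁰, −2σe¹, 0)`, i.e. the printed nilpotent matrix `N` with coefficient
   **`α₀ = β₁ = −2σ`**, where the papers print `+2σ` — audit datum SRC-A16 of the cell (found by two CAS engines 2026-08-18, here a
   kernel theorem; `src_A16`: the printed sign would force `σζ = 0`).  `−2σ = 2ζ_𝔱 = 2⟨ζ,∂_𝔱⟩`: the slip is `σ ↔ ζ_𝔱 = −σ`; the
   SIZE `2|σ|` of the block, which is all that H Lemma 6.4 (l.6021–6023) and Prop. 8.3 use, is as printed (modules 67, 68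
   prove those closing steps are sign-insensitive).  The same matrix holds in the normalised frame `𝖾^μ = 𝒞^{-1/2}e^μ` because
   `H_{G_b}𝒞 = 0` on `G_b⁻¹(0)` (item 4): there `∇_{H_G}(𝒞^{-1/2}e^μ) = 𝒞^{-1/2}∇_{H_G}e^μ` (`eq616c_frame_form` is the
   coefficient bookkeeping `∇_{H_G}e^μ = Σ_κ(−2σ N_{κμ})e^κ` against module 67's `Nmat`).
4. (§7) `HG_carterX`: `H_{G_b}𝒞 = a²·G_b·H_{G_b}(x²)` identically (so `K = 𝒞 − a²x²G_b` is the conserved quantity off shell,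
   GII l.2884), hence `HG_carterX_onshell`: `H_{G_b}𝒞 = 0` on `G_b⁻¹(0)`, exactly as H l.5988 states.
5. (§8) `schwarzschild_trapped_frame`: GII Remark 3.22 at `a = 0`, `r = 3𝔪`, `ξ = 0`: `e¹ = −9𝔪σ dr` ✓, `e³ = 3𝔪⋆η` ✓, and
   `e² = −(9𝔪²/2)(σ d𝔱 + η)` — the Remark prints `+(9𝔪²/2)`, incompatible with Lemma 3.20's `ĝ⁻¹(e⁰,e²) = −𝒞` (audit datum
   EXT-G13; GII is an input preprint, the Remark is used nowhere).

NOT formalised (taken as the textbook coordinate expressions, stated in the docstrings where used): that `Gam` IS the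
Levi-Civita connection and `nablaHG` the pull-back connection along `H_G` as invariant objects on `T*𝓜°` (we work in one chart
with the standard formulas `Γ = ½g⁻¹(∂g + ∂g − ∂g)`, `(∇_Xω)_ν = X(ω_ν) − Γ^λ_{κν}X^κω_λ`, `H_p = Σ ∂_ζp ∂_z − ∂_zp ∂_ζ`);
smoothness of `e^μ`; the structure of `Γ₀` and `𝒞 > 0` there ([AF]); (6.13) `S_sub(□) = −i∇^{π*T}` ([HintzPsdoInner]); the
2-tensor analogue Prop. 8.3 (its matrix step is module 68 `TrappingSubprincipalMatrix`, which takes (6.16c) as the input `N`).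
|a|-census (ADEP.md): NIL — every identity holds for all real `a`; the formulas degenerate only at `μ = 0` (horizons), `P = 0`,
`S = 0` (axis), as printed.  Engines (cell `pub-kerr`, `code/adep1-g22/`): A = `model.py` (stdlib exact rational functions,
x-chart; proposes every closed form of this file and asserts every identity before emission); B = `engineB_616c_theta.py`
(sympy, the ORIGINAL chart `(𝔱,r,θ,ϕ)` with the square-root tetrad (6.15) transcribed independently from the TeX; exact
arithmetic at random rational points of the circle `sin²+cos² = 1`): `∇e⁰ = ∇e³ = 0`, the `e¹`/`e²` columns with `−2σ`, `H_G𝒞`,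
(6.16a), the 64-entry Christoffel table of THIS file (parsed from the `.lean` text, compared symbolically), and Remark 3.22 — all
PASS; the 2026-08-18 engines of the cell (adep1 gen 5, GAPS C-A8) had found the same sign.
[cite: Hintz2026, §6.1: TeX l.5981 (σ), l.5984-5988 (Carter constant, momenta, conservation in the characteristic set),
eq. (6.15) l.5991-5997, frame l.5998-6003, (6.16a) l.6004-6008, (6.16b) l.6009-6013, eq. (6.16c) `EqWGTrMarckNabla`
l.6014-6019, proof of Lemma 6.4 l.6021-6023 (claims under review; the algebra of (6.16c) is reproduced here up to the sign
datum SRC-A16)] [cite: Hintz2024GluingII, §3.2.3: Hamiltonian vector field (EqGlDynKerrLocRestr) TeX l.2679-2681, Def. 3.12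
l.2723-2725, pull-back connection (EqGlDynTrDb) l.2852-2864, Carter constant l.2883-2890, Killing-Yano l.2891-2894, frame
l.2901-2919, Prop. 3.21 `PropGlDynTrNabla` l.2941-2963 ("A lengthy direct computation gives α₀ = 2σ", l.2960), Remark 3.22
l.2967-2977 (preprint; reproduced here up to SRC-A16 and the e² sign of Remark 3.22)] [cite: Carter1968, §4 (constant of motion)] [cite: Marck1983 (the frame; as cited by GII)]
-/

open Matrix

noncomputable section

namespace Literature.Geometry.Lorentzian.Hintz2026.MarckFrameConnection

open Literature.Geometry.Lorentzian.Hintz2026.KerrDualMetricForm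
open Literature.Geometry.Lorentzian.Hintz2026.CarterTetradFrame

/-! ## 1. Boyer–Lindquist Kerr in the chart `(𝔱, r, x, ϕ)`, `x = cos θ`: every component is rational in `(r, x)` -/

/-- `P := r² + a²x²` (`= ϱ_a² = r² + a²cos²θ` at `x = cos θ`, `Px_eq_rhoSq`). [cite: Hintz2026, TeX l.3589 (`ϱ_a² = r²+a²cos²θ`;
transcription in the variable x = cos θ)] -/
def Px (a r x : ℝ) : ℝ := r ^ 2 + a ^ 2 * x ^ 2

/-- `S := 1 − x²` (`= sin²θ`). [cite: Hintz2026, TeX l.3591 (BL display; transcription in x = cos θ)] -/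
def Sx (x : ℝ) : ℝ := 1 - x ^ 2

/-- `P = ϱ²` of `KerrDualMetricForm` with `s2 = sin²θ = 1 − x²`. [cite: Hintz2026, TeX l.3589 (computed)] -/
theorem Px_eq_rhoSq (a r x : ℝ) : Px a r x = rhoSq a r (1 - x ^ 2) := by
  unfold Px rhoSq; ring

/-- The BL Kerr metric `g_{𝔪,a}` in the coframe `(d𝔱, dr, dx, dϕ)`, `x = cos θ` (so `dθ² = dx²/(1−x²)`): `tt: −(μ − a²S)/P`,
`tϕ: aS(μ − r² − a²)/P (= −2𝔪raS/P)`, `rr: P/μ`, `xx: P/S`, `ϕϕ: S((r²+a²)² − a²Sμ)/P`, all other entries `0` — the printed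
display `g = −(μ/ϱ²)(d𝔱 − a sin²θ dϕ)² + ϱ²(dr²/μ + dθ²) + (sin²θ/ϱ²)((r²+a²)dϕ − a d𝔱)²` expanded (`gX_eq_GBL`). [cite:
Hintz2026, BL display TeX l.3591, v2 PDF p.71 (transcription in the x = cos θ chart)] -/
def gX (m a r x : ℝ) : Matrix (Fin 4) (Fin 4) ℝ :=
  Qsym ((-(mu m a r - a ^ 2 * Sx x)) / Px a r x) 0 0 (a * Sx x * (mu m a r - r ^ 2 - a ^ 2) / Px a r x) (Px a r x / mu m a r) 0 0
      (Px a r x / Sx x) 0 (Sx x * ((r ^ 2 + a ^ 2) ^ 2 - a ^ 2 * Sx x * mu m a r) / Px a r x)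

/-- The dual metric `g_{𝔪,a}⁻¹` in the frame `(∂_𝔱, ∂_r, ∂_x, ∂_ϕ)`: `tt: (−(r²+a²)²/μ + a²S)/P`, `tϕ: (−(r²+a²)a/μ + a)/P`,
`rr: μ/P`, `xx: S/P`, `ϕϕ: (−a²/μ + 1/S)/P` — the printed `ϱ²g⁻¹ = −μ⁻¹((r²+a²)∂_𝔱 + a∂_ϕ)² + μ∂_r² + ∂_θ² + sin⁻²θ(∂_ϕ + a
sin²θ∂_𝔱)²` with `∂_θ² = S∂_x²` (`gXinv_eq_QBL`). [cite: Hintz2026, dual BL display TeX l.3592, v2 PDF p.71 (transcription in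
the x = cos θ chart)] -/
def gXinv (m a r x : ℝ) : Matrix (Fin 4) (Fin 4) ℝ :=
  Qsym (((-((r ^ 2 + a ^ 2) ^ 2)) / mu m a r + a ^ 2 * Sx x) / Px a r x) 0 0 (((-((r ^ 2 + a ^ 2) * a)) / mu m a r + a) / Px a r
      x) (mu m a r / Px a r x) 0 0 (Sx x / Px a r x) 0 (((-(a ^ 2)) / mu m a r + 1 / Sx x) / Px a r x)

/-- `g · g⁻¹ = 1` in the x-chart, for ALL `(𝔪, a)` (`P, μ, S ≠ 0`). [cite: Hintz2026, TeX l.3591-3592 (computed)] -/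
theorem gX_mul_gXinv (m a r x : ℝ) (hP : Px a r x ≠ 0) (hD : mu m a r ≠ 0) (hS : Sx x ≠ 0) :
    gX m a r x * gXinv m a r x = 1 := by
  ext i j
  fin_cases i <;> fin_cases j <;> simp only [gX, gXinv, Matrix.mul_apply, Matrix.one_apply, Fin.sum_univ_four, Fin.zero_eta,
      Fin.mk_one, Fin.reduceFinMk, reduceIte, Fin.reduceEq, Qsym00, Qsym01, Qsym02, Qsym03, Qsym10, Qsym11, Qsym12, Qsym13,
      Qsym20, Qsym21, Qsym22, Qsym23, Qsym30, Qsym31, Qsym32, Qsym33, mul_zero, zero_mul, add_zero, zero_add] <;>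
    field_simp <;> (try simp only [Px, mu, Sx]) <;> ring

/-- … and `g⁻¹ · g = 1`. [cite: Hintz2026, TeX l.3591-3592 (computed)] -/
theorem gXinv_mul_gX (m a r x : ℝ) (hP : Px a r x ≠ 0) (hD : mu m a r ≠ 0) (hS : Sx x ≠ 0) :
    gXinv m a r x * gX m a r x = 1 := by
  ext i j
  fin_cases i <;> fin_cases j <;> simp only [gX, gXinv, Matrix.mul_apply, Matrix.one_apply, Fin.sum_univ_four, Fin.zero_eta,
      Fin.mk_one, Fin.reduceFinMk, reduceIte, Fin.reduceEq, Qsym00, Qsym01, Qsym02, Qsym03, Qsym10, Qsym11, Qsym12, Qsym13,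
      Qsym20, Qsym21, Qsym22, Qsym23, Qsym30, Qsym31, Qsym32, Qsym33, mul_zero, zero_mul, add_zero, zero_add] <;>
    field_simp <;> (try simp only [Px, mu, Sx]) <;> ring

/-- **Dictionary with `KerrDualMetricForm.GBL`** (the printed BL metric, coframe `(d𝔱,dr,dθ,dϕ)`, `s2 = sin²θ`): with
`s2 = 1 − x²` the x-chart components ARE the printed ones, except `xx = θθ/(1 − x²)` (`dθ² = dx²/sin²θ`).
[cite: Hintz2026, BL display TeX l.3591 (reproduced: change of variable θ ↦ x = cos θ)] -/
theorem gX_eq_GBL (m a r x : ℝ) (i j : Fin 4) :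
    gX m a r x i j = GBL m a r (1 - x ^ 2) i j *
      (!![1, 1, 1, 1; 1, 1, 1, 1; 1, 1, 1 / (1 - x ^ 2), 1; 1, 1, 1, 1] : Matrix (Fin 4) (Fin 4) ℝ) i j := by
  fin_cases i <;> fin_cases j <;> simp only [gX, GBL, ← Px_eq_rhoSq, Sx, Fin.zero_eta, Fin.mk_one, Fin.reduceFinMk,
      Matrix.cons_val, Matrix.of_apply, Qsym00, Qsym01, Qsym02, Qsym03, Qsym10, Qsym11, Qsym12, Qsym13, Qsym20, Qsym21, Qsym22,
      Qsym23, Qsym30, Qsym31, Qsym32, Qsym33, mul_one] <;> ring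

/-- **Dictionary with `KerrDualMetricForm.QBL`** (`QBL = ϱ²·g⁻¹` in the frame `(∂_𝔱,∂_r,∂_θ,∂_ϕ)`): `gXinv = QBL/ϱ²` except
`xx = (1 − x²)·θθ/ϱ²` (`∂_θ = −sin θ ∂_x`). [cite: Hintz2026, dual BL display TeX l.3592 (reproduced: change of variable)] -/
theorem gXinv_eq_QBL (m a r x : ℝ) (i j : Fin 4) :
    gXinv m a r x i j = QBL m a r (1 - x ^ 2) i j / rhoSq a r (1 - x ^ 2) *
      (!![1, 1, 1, 1; 1, 1, 1, 1; 1, 1, 1 - x ^ 2, 1; 1, 1, 1, 1] : Matrix (Fin 4) (Fin 4) ℝ) i j := by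
  fin_cases i <;> fin_cases j <;> simp only [gXinv, QBL, ← Px_eq_rhoSq, Sx, Fin.zero_eta, Fin.mk_one, Fin.reduceFinMk,
      Matrix.cons_val, Matrix.of_apply, Qsym00, Qsym01, Qsym02, Qsym03, Qsym10, Qsym11, Qsym12, Qsym13, Qsym20, Qsym21, Qsym22,
      Qsym23, Qsym30, Qsym31, Qsym32, Qsym33, mul_one] <;> ring

/-! ## 2. Certified partial derivatives `∂_r`, `∂_x` of the metric and dual metric components

Every derivative VALUE used below (`gXr`, `gXx`, `gXinvr`, `gXinvx`, and in §5 the frame derivatives) is an explicit rational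
expression — written in the raw quotient-rule form the chain rule produces, so that the certificate closes by `ring` — CERTIFIED
by a `HasDerivAt` theorem assembled from Mathlib's one-variable calculus; the closed forms a reader wants (`GamC`, `ZC`, `YC`)
are then PROVED from these. Nothing is differentiated by hand or by a CAS inside the trusted base. -/

/-- `∂_r μ = 2r − 2𝔪`. [cite: Hintz2026, TeX l.3589 (computed)] -/
theorem hasDerivAt_mu_r (m a r : ℝ) : HasDerivAt (fun r' => mu m a r') (2 * r - 2 * m) r := by
  unfold mu
  exact ((((hasDerivAt_id' (x := r)).fun_pow 2).fun_sub
    ((hasDerivAt_const r (2 * m)).fun_mul (hasDerivAt_id' (x := r)))).fun_add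
    (hasDerivAt_const r (a ^ 2))).congr_deriv (by ring)

/-- `∂_r P = 2r`. [cite: Hintz2026, TeX l.3589 (computed)] -/
theorem hasDerivAt_Px_r (a r x : ℝ) : HasDerivAt (fun r' => Px a r' x) (2 * r) r := by
  unfold Px
  exact (((hasDerivAt_id' (x := r)).fun_pow 2).fun_add (hasDerivAt_const r (a ^ 2 * x ^ 2))).congr_deriv (by ring)

/-- `∂_x P = 2a²x`. [cite: Hintz2026, TeX l.3589 (computed)] -/
theorem hasDerivAt_Px_x (a r x : ℝ) : HasDerivAt (fun x' => Px a r x') (2 * a ^ 2 * x) x := by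
  unfold Px
  exact ((hasDerivAt_const x (r ^ 2)).fun_add
    ((hasDerivAt_const x (a ^ 2)).fun_mul ((hasDerivAt_id' (x := x)).fun_pow 2))).congr_deriv (by ring)

/-- `∂_x S = −2x`. [cite: Hintz2026, TeX l.3591 (computed)] -/
theorem hasDerivAt_Sx (x : ℝ) : HasDerivAt (fun x' => Sx x') (-(2 * x)) x := by
  unfold Sx
  exact ((hasDerivAt_const x (1 : ℝ)).fun_sub ((hasDerivAt_id' (x := x)).fun_pow 2)).congr_deriv (by ring)

/-- `∂_r g` entrywise, in the quotient-rule form produced by the chain rule (certified by `hasDerivAt_gX_r`). [cite: Hintz2026,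
BL display TeX l.3591 (computed)] -/
def gXr (m a r x : ℝ) : Matrix (Fin 4) (Fin 4) ℝ :=
  Qsym (((-((2 * r - 2 * m) * Px a r x)) + (mu m a r - a ^ 2 * Sx x) * (2 * r)) / Px a r x ^ 2) 0 0 ((a * Sx x * (2 * r - 2 * m -
      2 * r) * Px a r x - a * Sx x * (mu m a r - r ^ 2 - a ^ 2) * (2 * r)) / Px a r x ^ 2) ((2 * r * mu m a r - Px a r x * (2 * r
      - 2 * m)) / mu m a r ^ 2) 0 0 (2 * r * Sx x / Sx x ^ 2) 0 ((Sx x * (2 * (r ^ 2 + a ^ 2) * (2 * r) - a ^ 2 * Sx x * (2 * r -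
      2 * m)) * Px a r x - Sx x * ((r ^ 2 + a ^ 2) ^ 2 - a ^ 2 * Sx x * mu m a r) * (2 * r)) / Px a r x ^ 2)

/-- **`∂_r g`, certified**: each entry of `gXr` is the `r`-derivative of the corresponding entry of `gX` (`P ≠ 0`, `μ ≠ 0` where
they are divided by). [cite: Hintz2026, BL display TeX l.3591 (computed)] -/
theorem hasDerivAt_gX_r (m a r x : ℝ) (hP : Px a r x ≠ 0) (hD : mu m a r ≠ 0) (hS : Sx x ≠ 0) (i j : Fin 4) :
    HasDerivAt (fun r' => gX m a r' x i j) (gXr m a r x i j) r := by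
  fin_cases i <;> fin_cases j <;>
    simp only [gX, gXr, Fin.zero_eta, Fin.mk_one, Fin.reduceFinMk, Qsym00, Qsym01, Qsym02, Qsym03, Qsym10, Qsym11, Qsym12, Qsym13,
        Qsym20, Qsym21, Qsym22, Qsym23, Qsym30, Qsym31, Qsym32, Qsym33] <;>
    try exact hasDerivAt_const _ _
  · -- entry (0,0)
    exact ((((hasDerivAt_mu_r m a r).fun_sub (hasDerivAt_const r (a ^ 2 * Sx x : ℝ))).fun_neg).fun_div (hasDerivAt_Px_r a r x)
        hP).congr_deriv (by ring)
  · -- entry (0,3)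
    exact (((hasDerivAt_const r (a * Sx x : ℝ)).fun_mul (((hasDerivAt_mu_r m a r).fun_sub ((hasDerivAt_id' (x := r)).fun_pow
        2)).fun_sub (hasDerivAt_const r (a ^ 2 : ℝ)))).fun_div (hasDerivAt_Px_r a r x) hP).congr_deriv (by ring)
  · -- entry (1,1)
    exact ((hasDerivAt_Px_r a r x).fun_div (hasDerivAt_mu_r m a r) hD).congr_deriv (by ring)
  · -- entry (2,2)
    exact ((hasDerivAt_Px_r a r x).fun_div (hasDerivAt_const r (Sx x : ℝ)) hS).congr_deriv (by ring)
  · -- entry (3,0)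
    exact (((hasDerivAt_const r (a * Sx x : ℝ)).fun_mul (((hasDerivAt_mu_r m a r).fun_sub ((hasDerivAt_id' (x := r)).fun_pow
        2)).fun_sub (hasDerivAt_const r (a ^ 2 : ℝ)))).fun_div (hasDerivAt_Px_r a r x) hP).congr_deriv (by ring)
  · -- entry (3,3)
    exact (((hasDerivAt_const r (Sx x : ℝ)).fun_mul (((((hasDerivAt_id' (x := r)).fun_pow 2).fun_add (hasDerivAt_const r (a ^ 2 :
        ℝ))).fun_pow 2).fun_sub ((hasDerivAt_const r (a ^ 2 * Sx x : ℝ)).fun_mul (hasDerivAt_mu_r m a r)))).fun_div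
        (hasDerivAt_Px_r a r x) hP).congr_deriv (by ring)

/-- `∂_x g` entrywise, quotient-rule form (certified by `hasDerivAt_gX_x`). [cite: Hintz2026, BL display TeX l.3591 (computed)] -/
def gXx (m a r x : ℝ) : Matrix (Fin 4) (Fin 4) ℝ :=
  Qsym (((-(a ^ 2 * (2 * x) * Px a r x)) + (mu m a r - a ^ 2 * Sx x) * (2 * a ^ 2 * x)) / Px a r x ^ 2) 0 0 (((-(a * (2 * x) * (mu
      m a r - r ^ 2 - a ^ 2) * Px a r x)) - a * Sx x * (mu m a r - r ^ 2 - a ^ 2) * (2 * a ^ 2 * x)) / Px a r x ^ 2) (2 * a ^ 2 *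
      x * mu m a r / mu m a r ^ 2) 0 0 ((2 * a ^ 2 * x * Sx x + Px a r x * (2 * x)) / Sx x ^ 2) 0 ((((-(2 * x * ((r ^ 2 + a ^ 2) ^
      2 - a ^ 2 * Sx x * mu m a r))) + Sx x * (a ^ 2 * (2 * x) * mu m a r)) * Px a r x - Sx x * ((r ^ 2 + a ^ 2) ^ 2 - a ^ 2 * Sx
      x * mu m a r) * (2 * a ^ 2 * x)) / Px a r x ^ 2)

/-- **`∂_x g`, certified**. [cite: Hintz2026, BL display TeX l.3591 (computed)] -/
theorem hasDerivAt_gX_x (m a r x : ℝ) (hP : Px a r x ≠ 0) (hD : mu m a r ≠ 0) (hS : Sx x ≠ 0) (i j : Fin 4) :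
    HasDerivAt (fun x' => gX m a r x' i j) (gXx m a r x i j) x := by
  fin_cases i <;> fin_cases j <;>
    simp only [gX, gXx, Fin.zero_eta, Fin.mk_one, Fin.reduceFinMk, Qsym00, Qsym01, Qsym02, Qsym03, Qsym10, Qsym11, Qsym12, Qsym13,
        Qsym20, Qsym21, Qsym22, Qsym23, Qsym30, Qsym31, Qsym32, Qsym33] <;>
    try exact hasDerivAt_const _ _
  · -- entry (0,0)
    exact ((((hasDerivAt_const x (mu m a r : ℝ)).fun_sub ((hasDerivAt_const x (a ^ 2 : ℝ)).fun_mul (hasDerivAt_Sx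
        x))).fun_neg).fun_div (hasDerivAt_Px_x a r x) hP).congr_deriv (by ring)
  · -- entry (0,3)
    exact ((((hasDerivAt_const x (a : ℝ)).fun_mul (hasDerivAt_Sx x)).fun_mul (hasDerivAt_const x (mu m a r - r ^ 2 - a ^ 2 :
        ℝ))).fun_div (hasDerivAt_Px_x a r x) hP).congr_deriv (by ring)
  · -- entry (1,1)
    exact ((hasDerivAt_Px_x a r x).fun_div (hasDerivAt_const x (mu m a r : ℝ)) hD).congr_deriv (by ring)
  · -- entry (2,2)
    exact ((hasDerivAt_Px_x a r x).fun_div (hasDerivAt_Sx x) hS).congr_deriv (by ring)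
  · -- entry (3,0)
    exact ((((hasDerivAt_const x (a : ℝ)).fun_mul (hasDerivAt_Sx x)).fun_mul (hasDerivAt_const x (mu m a r - r ^ 2 - a ^ 2 :
        ℝ))).fun_div (hasDerivAt_Px_x a r x) hP).congr_deriv (by ring)
  · -- entry (3,3)
    exact (((hasDerivAt_Sx x).fun_mul ((hasDerivAt_const x ((r ^ 2 + a ^ 2) ^ 2 : ℝ)).fun_sub (((hasDerivAt_const x (a ^ 2 :
        ℝ)).fun_mul (hasDerivAt_Sx x)).fun_mul (hasDerivAt_const x (mu m a r : ℝ))))).fun_div (hasDerivAt_Px_x a r x)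
        hP).congr_deriv (by ring)

/-- `∂_r g⁻¹` entrywise, quotient-rule form (certified by `hasDerivAt_gXinv_r`). [cite: Hintz2026, dual BL display TeX l.3592 (computed)] -/
def gXinvr (m a r x : ℝ) : Matrix (Fin 4) (Fin 4) ℝ :=
  Qsym ((((-(2 * (r ^ 2 + a ^ 2) * (2 * r) * mu m a r)) + (r ^ 2 + a ^ 2) ^ 2 * (2 * r - 2 * m)) / mu m a r ^ 2 * Px a r x -
      ((-((r ^ 2 + a ^ 2) ^ 2 / mu m a r)) + a ^ 2 * Sx x) * (2 * r)) / Px a r x ^ 2) 0 0 ((((-(2 * r * a * mu m a r)) + (r ^ 2 +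
      a ^ 2) * a * (2 * r - 2 * m)) / mu m a r ^ 2 * Px a r x - ((-((r ^ 2 + a ^ 2) * a / mu m a r)) + a) * (2 * r)) / Px a r x ^
      2) (((2 * r - 2 * m) * Px a r x - mu m a r * (2 * r)) / Px a r x ^ 2) 0 0 (-(Sx x * (2 * r) / Px a r x ^ 2)) 0 ((a ^ 2 * (2
      * r - 2 * m) / mu m a r ^ 2 * Px a r x - ((-(a ^ 2 / mu m a r)) + 1 / Sx x) * (2 * r)) / Px a r x ^ 2)

/-- **`∂_r g⁻¹`, certified**. [cite: Hintz2026, dual BL display TeX l.3592 (computed)] -/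
theorem hasDerivAt_gXinv_r (m a r x : ℝ) (hP : Px a r x ≠ 0) (hD : mu m a r ≠ 0) (i j : Fin 4) :
    HasDerivAt (fun r' => gXinv m a r' x i j) (gXinvr m a r x i j) r := by
  fin_cases i <;> fin_cases j <;>
    simp only [gXinv, gXinvr, Fin.zero_eta, Fin.mk_one, Fin.reduceFinMk, Qsym00, Qsym01, Qsym02, Qsym03, Qsym10, Qsym11, Qsym12,
        Qsym13, Qsym20, Qsym21, Qsym22, Qsym23, Qsym30, Qsym31, Qsym32, Qsym33] <;>
    try exact hasDerivAt_const _ _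
  · -- entry (0,0)
    exact ((((((((hasDerivAt_id' (x := r)).fun_pow 2).fun_add (hasDerivAt_const r (a ^ 2 : ℝ))).fun_pow 2).fun_neg).fun_div
        (hasDerivAt_mu_r m a r) hD).fun_add (hasDerivAt_const r (a ^ 2 * Sx x : ℝ))).fun_div (hasDerivAt_Px_r a r x)
        hP).congr_deriv (by ring)
  · -- entry (0,3)
    exact ((((((((hasDerivAt_id' (x := r)).fun_pow 2).fun_add (hasDerivAt_const r (a ^ 2 : ℝ))).fun_mul (hasDerivAt_const r (a :
        ℝ))).fun_neg).fun_div (hasDerivAt_mu_r m a r) hD).fun_add (hasDerivAt_const r (a : ℝ))).fun_div (hasDerivAt_Px_r a r x)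
        hP).congr_deriv (by ring)
  · -- entry (1,1)
    exact ((hasDerivAt_mu_r m a r).fun_div (hasDerivAt_Px_r a r x) hP).congr_deriv (by ring)
  · -- entry (2,2)
    exact ((hasDerivAt_const r (Sx x : ℝ)).fun_div (hasDerivAt_Px_r a r x) hP).congr_deriv (by ring)
  · -- entry (3,0)
    exact ((((((((hasDerivAt_id' (x := r)).fun_pow 2).fun_add (hasDerivAt_const r (a ^ 2 : ℝ))).fun_mul (hasDerivAt_const r (a :
        ℝ))).fun_neg).fun_div (hasDerivAt_mu_r m a r) hD).fun_add (hasDerivAt_const r (a : ℝ))).fun_div (hasDerivAt_Px_r a r x)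
        hP).congr_deriv (by ring)
  · -- entry (3,3)
    exact ((((hasDerivAt_const r (-(a ^ 2) : ℝ)).fun_div (hasDerivAt_mu_r m a r) hD).fun_add (hasDerivAt_const r (1 / Sx x :
        ℝ))).fun_div (hasDerivAt_Px_r a r x) hP).congr_deriv (by ring)

/-- `∂_x g⁻¹` entrywise, quotient-rule form (certified by `hasDerivAt_gXinv_x`). [cite: Hintz2026, dual BL display TeX l.3592 (computed)] -/
def gXinvx (m a r x : ℝ) : Matrix (Fin 4) (Fin 4) ℝ :=
  Qsym (((-(a ^ 2 * (2 * x) * Px a r x)) - ((-((r ^ 2 + a ^ 2) ^ 2 / mu m a r)) + a ^ 2 * Sx x) * (2 * a ^ 2 * x)) / Px a r x ^ 2)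
      0 0 (-(((-((r ^ 2 + a ^ 2) * a / mu m a r)) + a) * (2 * a ^ 2 * x) / Px a r x ^ 2)) (-(mu m a r * (2 * a ^ 2 * x) / Px a r x
      ^ 2)) 0 0 (((-(2 * x * Px a r x)) - Sx x * (2 * a ^ 2 * x)) / Px a r x ^ 2) 0 ((2 * x / Sx x ^ 2 * Px a r x - ((-(a ^ 2 / mu
      m a r)) + 1 / Sx x) * (2 * a ^ 2 * x)) / Px a r x ^ 2)

/-- **`∂_x g⁻¹`, certified**. [cite: Hintz2026, dual BL display TeX l.3592 (computed)] -/
theorem hasDerivAt_gXinv_x (m a r x : ℝ) (hP : Px a r x ≠ 0) (hS : Sx x ≠ 0) (i j : Fin 4) :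
    HasDerivAt (fun x' => gXinv m a r x' i j) (gXinvx m a r x i j) x := by
  fin_cases i <;> fin_cases j <;>
    simp only [gXinv, gXinvx, Fin.zero_eta, Fin.mk_one, Fin.reduceFinMk, Qsym00, Qsym01, Qsym02, Qsym03, Qsym10, Qsym11, Qsym12,
        Qsym13, Qsym20, Qsym21, Qsym22, Qsym23, Qsym30, Qsym31, Qsym32, Qsym33] <;>
    try exact hasDerivAt_const _ _
  · -- entry (0,0)
    exact (((hasDerivAt_const x ((-((r ^ 2 + a ^ 2) ^ 2)) / mu m a r : ℝ)).fun_add ((hasDerivAt_const x (a ^ 2 : ℝ)).fun_mul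
        (hasDerivAt_Sx x))).fun_div (hasDerivAt_Px_x a r x) hP).congr_deriv (by ring)
  · -- entry (0,3)
    exact ((hasDerivAt_const x ((-((r ^ 2 + a ^ 2) * a)) / mu m a r + a : ℝ)).fun_div (hasDerivAt_Px_x a r x) hP).congr_deriv (by
        ring)
  · -- entry (1,1)
    exact ((hasDerivAt_const x (mu m a r : ℝ)).fun_div (hasDerivAt_Px_x a r x) hP).congr_deriv (by ring)
  · -- entry (2,2)
    exact ((hasDerivAt_Sx x).fun_div (hasDerivAt_Px_x a r x) hP).congr_deriv (by ring)
  · -- entry (3,0)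
    exact ((hasDerivAt_const x ((-((r ^ 2 + a ^ 2) * a)) / mu m a r + a : ℝ)).fun_div (hasDerivAt_Px_x a r x) hP).congr_deriv (by
        ring)
  · -- entry (3,3)
    exact (((hasDerivAt_const x ((-(a ^ 2)) / mu m a r : ℝ)).fun_add ((hasDerivAt_const x (1 : ℝ)).fun_div (hasDerivAt_Sx x)
        hS)).fun_div (hasDerivAt_Px_x a r x) hP).congr_deriv (by ring)

/-! ## 3. The Christoffel symbols of `g_{𝔪,a}` in the chart `(𝔱, r, x, ϕ)`, from the Koszul formula -/

/-- Coordinate derivatives of the metric: `∂_𝔱 g = ∂_ϕ g = 0` (the components do not depend on `𝔱, ϕ`), `∂_r g = gXr`,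
`∂_x g = gXx` (certified, §2). [cite: Hintz2026, BL display TeX l.3591 (computed)] -/
def dgX (m a r x : ℝ) (k : Fin 4) : Matrix (Fin 4) (Fin 4) ℝ :=
  (![0, gXr m a r x, gXx m a r x, 0] : Fin 4 → Matrix (Fin 4) (Fin 4) ℝ) k

/-- **Christoffel symbols** `Γ^l_{kn} = ½ g^{lρ}(∂_k g_{ρn} + ∂_n g_{ρk} − ∂_ρ g_{kn})` of the Levi-Civita connection of `g_{𝔪,a}`
in the chart `(𝔱, r, x, ϕ)` (indices `0 = 𝔱, 1 = r, 2 = x, 3 = ϕ`). [folklore] (Koszul formula; metric of [cite: Hintz2026, TeX l.3591]) -/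
def Gam (m a r x : ℝ) (l k n : Fin 4) : ℝ :=
  1 / 2 * ∑ ρ, gXinv m a r x l ρ * (dgX m a r x k ρ n + dgX m a r x n ρ k - dgX m a r x ρ k n)

/-- The twenty non-vanishing Christoffel symbols in CLOSED FORM (symmetric in `k,n`; `x = cos θ`, `S = sin²θ`, `P = ϱ²`), e.g.
`Γ^r_{𝔱𝔱} = 𝔪μ(r² − a²x²)/P³`, `Γ^r_{rr} = (𝔪(a²x² − r²) + a²r(1 − x²))/(Pμ)`, `Γ^x_{rx} = r/P`, `Γ^r_{xx} = −rμ/(PS)`;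
proposed by the cell's CAS, PROVED equal to the Koszul formula in `Gam_eq`. [folklore] (Kerr Christoffel symbols; computed here) -/
def GamC (m a r x : ℝ) (l : Fin 4) : Matrix (Fin 4) (Fin 4) ℝ :=
  (![Qsym 0 (-(m * (a ^ 4 * x ^ 2 + a ^ 2 * r ^ 2 * x ^ 2 - a ^ 2 * r ^ 2 - r ^ 4) / (Px a r x ^ 2 * mu m a r))) (2 * m * a ^ 2 *
      r * x / Px a r x ^ 2) 0 0 0 (m * a * Sx x * (a ^ 4 * x ^ 2 - a ^ 2 * r ^ 2 * x ^ 2 - a ^ 2 * r ^ 2 - 3 * r ^ 4) / (Px a r x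
      ^ 2 * mu m a r)) 0 (-(2 * m * a ^ 3 * r * x * Sx x / Px a r x ^ 2)) 0,
    Qsym (-(m * mu m a r * (a ^ 2 * x ^ 2 - r ^ 2) / Px a r x ^ 3)) 0 0 (m * a * mu m a r * Sx x * (a ^ 2 * x ^ 2 - r ^ 2) / Px a
        r x ^ 3) ((m * a ^ 2 * x ^ 2 - m * r ^ 2 - a ^ 2 * r * x ^ 2 + a ^ 2 * r) / (Px a r x * mu m a r)) (a ^ 2 * x / Px a r x)
        0 (-(r * mu m a r / (Px a r x * Sx x))) 0 (mu m a r * Sx x * (m * a ^ 4 * x ^ 4 - m * a ^ 4 * x ^ 2 - m * a ^ 2 * r ^ 2 *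
        x ^ 2 + m * a ^ 2 * r ^ 2 - a ^ 4 * r * x ^ 4 - 2 * a ^ 2 * r ^ 3 * x ^ 2 - r ^ 5) / Px a r x ^ 3),
    Qsym (2 * m * a ^ 2 * r * x * Sx x / Px a r x ^ 3) 0 0 (-(2 * m * a * r * x * Sx x * (a ^ 2 + r ^ 2) / Px a r x ^ 3)) (-(a ^ 2
        * x * Sx x / (Px a r x * mu m a r))) (r / Px a r x) 0 (x * (a ^ 2 + r ^ 2) / (Px a r x * Sx x)) 0 (-(x * Sx x * (2 * m * a
        ^ 4 * r * x ^ 4 - 2 * m * a ^ 4 * r + 4 * m * a ^ 2 * r ^ 3 * x ^ 2 - 4 * m * a ^ 2 * r ^ 3 - a ^ 6 * x ^ 4 - a ^ 4 * r ^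
        2 * x ^ 4 - 2 * a ^ 4 * r ^ 2 * x ^ 2 - 2 * a ^ 2 * r ^ 4 * x ^ 2 - a ^ 2 * r ^ 4 - r ^ 6) / Px a r x ^ 3)),
    Qsym 0 (-(m * a * (a ^ 2 * x ^ 2 - r ^ 2) / (Px a r x ^ 2 * mu m a r))) (2 * m * a * r * x / (Px a r x ^ 2 * Sx x)) 0 0 0
        (-((m * a ^ 4 * x ^ 4 - m * a ^ 4 * x ^ 2 + m * a ^ 2 * r ^ 2 * x ^ 2 + m * a ^ 2 * r ^ 2 + 2 * m * r ^ 4 - a ^ 4 * r * x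
        ^ 4 - 2 * a ^ 2 * r ^ 3 * x ^ 2 - r ^ 5) / (Px a r x ^ 2 * mu m a r))) 0 (x * (2 * m * a ^ 2 * r * x ^ 2 - 2 * m * a ^ 2 *
        r - a ^ 4 * x ^ 4 - 2 * a ^ 2 * r ^ 2 * x ^ 2 - r ^ 4) / (Px a r x ^ 2 * Sx x)) 0] : Fin 4 → Matrix (Fin 4) (Fin 4) ℝ) l

/-- **The Koszul formula evaluates to the closed-form table, upper index `𝔱`**: `Γ^𝔱_{kn} = GamC 0 k n` for all `k, n`
and ALL `(𝔪, a)` (`P, μ, S ≠ 0`). [folklore] (Kerr Christoffel symbols; kernel computation from [cite: Hintz2026, TeX l.3591-3592]) -/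
theorem Gam_eq_0 (m a r x : ℝ) (hP : Px a r x ≠ 0) (hD : mu m a r ≠ 0) (hS : Sx x ≠ 0) (k n : Fin 4) :
    Gam m a r x 0 k n = GamC m a r x 0 k n := by
  fin_cases k <;> fin_cases n <;>
    simp only [Gam, GamC, dgX, gXinv, gXr, gXx, Fin.sum_univ_four, Fin.zero_eta, Fin.mk_one, Fin.reduceFinMk, Matrix.cons_val,
        Matrix.zero_apply, Qsym00, Qsym01, Qsym02, Qsym03, Qsym10, Qsym11, Qsym12, Qsym13, Qsym20, Qsym21, Qsym22, Qsym23, Qsym30,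
        Qsym31, Qsym32, Qsym33, mul_zero, zero_mul, add_zero, zero_add, sub_zero, zero_sub, neg_zero] <;>
    field_simp <;> (try simp only [Px, mu, Sx]) <;> ring

/-- **The Koszul formula evaluates to the closed-form table, upper index `r`**: `Γ^r_{kn} = GamC 1 k n` for all `k, n`
and ALL `(𝔪, a)` (`P, μ, S ≠ 0`). [folklore] (Kerr Christoffel symbols; kernel computation from [cite: Hintz2026, TeX l.3591-3592]) -/
theorem Gam_eq_1 (m a r x : ℝ) (hP : Px a r x ≠ 0) (hD : mu m a r ≠ 0) (hS : Sx x ≠ 0) (k n : Fin 4) :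
    Gam m a r x 1 k n = GamC m a r x 1 k n := by
  fin_cases k <;> fin_cases n <;>
    simp only [Gam, GamC, dgX, gXinv, gXr, gXx, Fin.sum_univ_four, Fin.zero_eta, Fin.mk_one, Fin.reduceFinMk, Matrix.cons_val,
        Matrix.zero_apply, Qsym00, Qsym01, Qsym02, Qsym03, Qsym10, Qsym11, Qsym12, Qsym13, Qsym20, Qsym21, Qsym22, Qsym23, Qsym30,
        Qsym31, Qsym32, Qsym33, mul_zero, zero_mul, add_zero, zero_add, sub_zero, zero_sub, neg_zero] <;>
    field_simp <;> (try simp only [Px, mu, Sx]) <;> ring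

/-- **The Koszul formula evaluates to the closed-form table, upper index `x`**: `Γ^x_{kn} = GamC 2 k n` for all `k, n`
and ALL `(𝔪, a)` (`P, μ, S ≠ 0`). [folklore] (Kerr Christoffel symbols; kernel computation from [cite: Hintz2026, TeX l.3591-3592]) -/
theorem Gam_eq_2 (m a r x : ℝ) (hP : Px a r x ≠ 0) (hD : mu m a r ≠ 0) (hS : Sx x ≠ 0) (k n : Fin 4) :
    Gam m a r x 2 k n = GamC m a r x 2 k n := by
  fin_cases k <;> fin_cases n <;>
    simp only [Gam, GamC, dgX, gXinv, gXr, gXx, Fin.sum_univ_four, Fin.zero_eta, Fin.mk_one, Fin.reduceFinMk, Matrix.cons_val,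
        Matrix.zero_apply, Qsym00, Qsym01, Qsym02, Qsym03, Qsym10, Qsym11, Qsym12, Qsym13, Qsym20, Qsym21, Qsym22, Qsym23, Qsym30,
        Qsym31, Qsym32, Qsym33, mul_zero, zero_mul, add_zero, zero_add, sub_zero, zero_sub, neg_zero] <;>
    field_simp <;> (try simp only [Px, mu, Sx]) <;> ring

/-- **The Koszul formula evaluates to the closed-form table, upper index `ϕ`**: `Γ^ϕ_{kn} = GamC 3 k n` for all `k, n`
and ALL `(𝔪, a)` (`P, μ, S ≠ 0`). [folklore] (Kerr Christoffel symbols; kernel computation from [cite: Hintz2026, TeX l.3591-3592]) -/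
theorem Gam_eq_3 (m a r x : ℝ) (hP : Px a r x ≠ 0) (hD : mu m a r ≠ 0) (hS : Sx x ≠ 0) (k n : Fin 4) :
    Gam m a r x 3 k n = GamC m a r x 3 k n := by
  fin_cases k <;> fin_cases n <;>
    simp only [Gam, GamC, dgX, gXinv, gXr, gXx, Fin.sum_univ_four, Fin.zero_eta, Fin.mk_one, Fin.reduceFinMk, Matrix.cons_val,
        Matrix.zero_apply, Qsym00, Qsym01, Qsym02, Qsym03, Qsym10, Qsym11, Qsym12, Qsym13, Qsym20, Qsym21, Qsym22, Qsym23, Qsym30,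
        Qsym31, Qsym32, Qsym33, mul_zero, zero_mul, add_zero, zero_add, sub_zero, zero_sub, neg_zero] <;>
    field_simp <;> (try simp only [Px, mu, Sx]) <;> ring

/-- **`Γ = GamC`**: the Koszul formula from the certified `∂g` equals the closed-form table, all indices, ALL `(𝔪, a)`.
[folklore] (Kerr Christoffel symbols in Boyer–Lindquist-type coordinates; computed here) -/
theorem Gam_eq (m a r x : ℝ) (hP : Px a r x ≠ 0) (hD : mu m a r ≠ 0) (hS : Sx x ≠ 0) (l k n : Fin 4) :
    Gam m a r x l k n = GamC m a r x l k n := by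
  fin_cases l
  · exact Gam_eq_0 m a r x hP hD hS k n
  · exact Gam_eq_1 m a r x hP hD hS k n
  · exact Gam_eq_2 m a r x hP hD hS k n
  · exact Gam_eq_3 m a r x hP hD hS k n

/-! ## 4. Phase space `T*𝓜°`: the dual metric function `G_b`, its Hamiltonian vector field, the pull-back connection

Points of `T*𝓜°` over the chart: `(𝔱, r, x, ϕ; ζ)` with `ζ = ζ_𝔱 d𝔱 + ζ_r dr + ζ_x dx + ζ_ϕ dϕ`, `ζ : Fin 4 → ℝ`; Hintz's momenta
(H l.5988: covectors `−σ d𝔱 + ξ dr + η_θ dθ + η_ϕ dϕ`) are `σ = −ζ 0`, `ξ = ζ 1`, `η_θ = −sin θ·ζ 2`, `η_ϕ = ζ 3`. -/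

/-- The quadratic form `ζ ↦ ζ·M·ζ = Σ_{ij} ζ_i M_{ij} ζ_j` of a component matrix. [folklore] -/
def Gfun (M : Matrix (Fin 4) (Fin 4) ℝ) (ζ : Fin 4 → ℝ) : ℝ := ∑ i, ∑ j, ζ i * M i j * ζ j

/-- `Gfun M ζ = ζ ⬝ᵥ M ζ`. [folklore] -/
theorem Gfun_eq_dotProduct (M : Matrix (Fin 4) (Fin 4) ℝ) (ζ : Fin 4 → ℝ) : Gfun M ζ = ζ ⬝ᵥ M.mulVec ζ := by
  simp only [Gfun, dotProduct, Matrix.mulVec, Finset.mul_sum]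
  exact Finset.sum_congr rfl fun i _ => Finset.sum_congr rfl fun j _ => by ring

/-- Hintz's `σ = −⟨ζ, ∂_𝔱⟩` ("the (negative) time momentum", H l.5981; covectors `−σ d𝔱 + …`, H l.5988). [cite: Hintz2026, TeX
l.5981 and l.5988 (transcription)] -/
def sigmaOf (ζ : Fin 4 → ℝ) : ℝ := -ζ 0

/-- **The dual metric function** `G_b(ζ) := g_b⁻¹(ζ, ζ)` (H l.5988) in the x-chart. [cite: Hintz2026, TeX l.5988 (transcription)] -/
def Gb (m a r x : ℝ) (ζ : Fin 4 → ℝ) : ℝ := Gfun (gXinv m a r x) ζ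

/-- `∂G_b/∂ζ_k = Σ_j (g^{kj} + g^{jk})ζ_j` (`= 2(g⁻¹ζ)^k`, `Zvec_eq_two_mulVec`): the base component `π_*H_{G_b} = 2ζ♯` of the
Hamiltonian vector field (GII l.2864: "the pushforward of `H_{Ĝ_b}` along `π` is twice the vector dual to `ζ`"); certified as the
momentum-derivative of `Gb` in `hasDerivAt_Gb_mom`. [cite: Hintz2024GluingII, TeX l.2864 (reproduced)] -/
def Zvec (m a r x : ℝ) (ζ : Fin 4 → ℝ) (k : Fin 4) : ℝ := ∑ j, (gXinv m a r x k j + gXinv m a r x j k) * ζ j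

/-- `∂_r G_b = ζ·(∂_r g⁻¹)·ζ` (certified: `hasDerivAt_Gb_r`). [cite: Hintz2026, TeX l.5988 (computed)] -/
def dGr (m a r x : ℝ) (ζ : Fin 4 → ℝ) : ℝ := Gfun (gXinvr m a r x) ζ

/-- `∂_x G_b = ζ·(∂_x g⁻¹)·ζ` (certified: `hasDerivAt_Gb_x`). [cite: Hintz2026, TeX l.5988 (computed)] -/
def dGx (m a r x : ℝ) (ζ : Fin 4 → ℝ) : ℝ := Gfun (gXinvx m a r x) ζ

/-- Sum rule: the quadratic form of a differentiable matrix family is differentiable, with the expected derivative. [folklore] -/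
theorem hasDerivAt_Gfun {Mf : ℝ → Matrix (Fin 4) (Fin 4) ℝ} {M' : Matrix (Fin 4) (Fin 4) ℝ} {t : ℝ}
    (h : ∀ i j, HasDerivAt (fun s => Mf s i j) (M' i j) t) (ζ : Fin 4 → ℝ) :
    HasDerivAt (fun s => Gfun (Mf s) ζ) (Gfun M' ζ) t := by
  unfold Gfun
  refine HasDerivAt.fun_sum fun i _ => HasDerivAt.fun_sum fun j _ => ?_
  exact (((hasDerivAt_const t (ζ i)).fun_mul (h i j)).fun_mul (hasDerivAt_const t (ζ j))).congr_deriv (by ring)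

/-- **`∂_r G_b` certified.** [cite: Hintz2026, TeX l.5988 (computed)] -/
theorem hasDerivAt_Gb_r (m a r x : ℝ) (ζ : Fin 4 → ℝ) (hP : Px a r x ≠ 0) (hD : mu m a r ≠ 0) :
    HasDerivAt (fun r' => Gb m a r' x ζ) (dGr m a r x ζ) r :=
  hasDerivAt_Gfun (hasDerivAt_gXinv_r m a r x hP hD) ζ

/-- **`∂_x G_b` certified.** [cite: Hintz2026, TeX l.5988 (computed)] -/
theorem hasDerivAt_Gb_x (m a r x : ℝ) (ζ : Fin 4 → ℝ) (hP : Px a r x ≠ 0) (hS : Sx x ≠ 0) :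
    HasDerivAt (fun x' => Gb m a r x' ζ) (dGx m a r x ζ) x :=
  hasDerivAt_Gfun (hasDerivAt_gXinv_x m a r x hP hS) ζ

/-- Momentum gradient of a quadratic form: `∂/∂ζ_k (ζ·M·ζ) = Σ_j (M_{kj} + M_{jk})ζ_j`. [folklore] -/
theorem hasDerivAt_Gfun_update (M : Matrix (Fin 4) (Fin 4) ℝ) (ζ : Fin 4 → ℝ) (k : Fin 4) :
    HasDerivAt (fun t => Gfun M (Function.update ζ k t)) (∑ j, (M k j + M j k) * ζ j) (ζ k) := by
  fin_cases k
  · have h : (fun t => Gfun M (Function.update ζ 0 t)) = fun t =>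
        Gfun M ζ + (t - ζ 0) * (∑ j, (M 0 j + M j 0) * ζ j) + (t - ζ 0) ^ 2 * M 0 0 := by
      funext t
      simp only [Gfun, Fin.sum_univ_four, Fin.isValue, Function.update_self, ne_eq, Fin.reduceEq,
        not_false_eq_true, Function.update_of_ne]
      ring
    simp only [Fin.zero_eta, Fin.isValue]
    rw [h]
    exact (((hasDerivAt_const (ζ 0) (Gfun M ζ)).fun_add (((hasDerivAt_id' (x := ζ 0)).sub_const (ζ 0)).fun_mul
      (hasDerivAt_const (ζ 0) _))).fun_add ((((hasDerivAt_id' (x := ζ 0)).sub_const (ζ 0)).fun_pow 2).fun_mul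
      (hasDerivAt_const (ζ 0) (M 0 0)))).congr_deriv (by ring)
  · have h : (fun t => Gfun M (Function.update ζ 1 t)) = fun t =>
        Gfun M ζ + (t - ζ 1) * (∑ j, (M 1 j + M j 1) * ζ j) + (t - ζ 1) ^ 2 * M 1 1 := by
      funext t
      simp only [Gfun, Fin.sum_univ_four, Fin.isValue, Function.update_self, ne_eq, Fin.reduceEq,
        not_false_eq_true, Function.update_of_ne]
      ring
    simp only [Fin.mk_one, Fin.isValue]
    rw [h]
    exact (((hasDerivAt_const (ζ 1) (Gfun M ζ)).fun_add (((hasDerivAt_id' (x := ζ 1)).sub_const (ζ 1)).fun_mul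
      (hasDerivAt_const (ζ 1) _))).fun_add ((((hasDerivAt_id' (x := ζ 1)).sub_const (ζ 1)).fun_pow 2).fun_mul
      (hasDerivAt_const (ζ 1) (M 1 1)))).congr_deriv (by ring)
  · have h : (fun t => Gfun M (Function.update ζ 2 t)) = fun t =>
        Gfun M ζ + (t - ζ 2) * (∑ j, (M 2 j + M j 2) * ζ j) + (t - ζ 2) ^ 2 * M 2 2 := by
      funext t
      simp only [Gfun, Fin.sum_univ_four, Fin.isValue, Function.update_self, ne_eq, Fin.reduceEq,
        not_false_eq_true, Function.update_of_ne]
      ring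
    simp only [Fin.reduceFinMk, Fin.isValue]
    rw [h]
    exact (((hasDerivAt_const (ζ 2) (Gfun M ζ)).fun_add (((hasDerivAt_id' (x := ζ 2)).sub_const (ζ 2)).fun_mul
      (hasDerivAt_const (ζ 2) _))).fun_add ((((hasDerivAt_id' (x := ζ 2)).sub_const (ζ 2)).fun_pow 2).fun_mul
      (hasDerivAt_const (ζ 2) (M 2 2)))).congr_deriv (by ring)
  · have h : (fun t => Gfun M (Function.update ζ 3 t)) = fun t =>
        Gfun M ζ + (t - ζ 3) * (∑ j, (M 3 j + M j 3) * ζ j) + (t - ζ 3) ^ 2 * M 3 3 := by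
      funext t
      simp only [Gfun, Fin.sum_univ_four, Fin.isValue, Function.update_self, ne_eq, Fin.reduceEq,
        not_false_eq_true, Function.update_of_ne]
      ring
    simp only [Fin.reduceFinMk, Fin.isValue]
    rw [h]
    exact (((hasDerivAt_const (ζ 3) (Gfun M ζ)).fun_add (((hasDerivAt_id' (x := ζ 3)).sub_const (ζ 3)).fun_mul
      (hasDerivAt_const (ζ 3) _))).fun_add ((((hasDerivAt_id' (x := ζ 3)).sub_const (ζ 3)).fun_pow 2).fun_mul
      (hasDerivAt_const (ζ 3) (M 3 3)))).congr_deriv (by ring)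

/-- **`∂G_b/∂ζ_k = Zvec k` certified.** [cite: Hintz2024GluingII, TeX l.2864 (reproduced)] -/
theorem hasDerivAt_Gb_mom (m a r x : ℝ) (ζ : Fin 4 → ℝ) (k : Fin 4) :
    HasDerivAt (fun t => Gb m a r x (Function.update ζ k t)) (Zvec m a r x ζ k) (ζ k) :=
  hasDerivAt_Gfun_update (gXinv m a r x) ζ k

/-- `Zvec = 2 g⁻¹ζ` (the dual metric is symmetric). [cite: Hintz2024GluingII, TeX l.2864 ("twice the vector dual to ζ"; reproduced)] -/
theorem Zvec_eq_two_mulVec (m a r x : ℝ) (ζ : Fin 4 → ℝ) (k : Fin 4) :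
    Zvec m a r x ζ k = 2 * (gXinv m a r x).mulVec ζ k := by
  fin_cases k <;> simp only [Zvec, gXinv, Matrix.mulVec, dotProduct, Fin.sum_univ_four, Fin.zero_eta, Fin.mk_one, Fin.reduceFinMk,
      Qsym00, Qsym01, Qsym02, Qsym03, Qsym10, Qsym11, Qsym12, Qsym13, Qsym20, Qsym21, Qsym22, Qsym23, Qsym30, Qsym31, Qsym32,
      Qsym33, zero_mul, add_zero, zero_add] <;> ring

/-- Closed forms of `Z^k = ∂G_b/∂ζ_k`: `Z^r = 2μξ/P`, `Z^x = 2Sζ_x/P`, and the `𝔱, ϕ` components. [cite: Hintz2024GluingII, TeX l.2864 (computed)] -/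
def ZC (m a r x : ℝ) (ζ : Fin 4 → ℝ) : Fin 4 → ℝ :=
  ![2 * (2 * m * a ^ 2 * r * x ^ 2 * ζ 0 - 2 * m * a ^ 2 * r * ζ 0 - 2 * m * a * r * ζ 3 - a ^ 4 * x ^ 2 * ζ 0 - a ^ 2 * r ^ 2 * x
      ^ 2 * ζ 0 - a ^ 2 * r ^ 2 * ζ 0 - r ^ 4 * ζ 0) / (Px a r x * mu m a r),
    2 * ζ 1 * mu m a r / Px a r x,
    2 * ζ 2 * Sx x / Px a r x,
    2 * (2 * m * a * r * x ^ 2 * ζ 0 - 2 * m * a * r * ζ 0 - 2 * m * r * ζ 3 + a ^ 2 * x ^ 2 * ζ 3 + r ^ 2 * ζ 3) / (Px a r x * mu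
        m a r * Sx x)]

/-- `Zvec = ZC` (`P, μ, S ≠ 0`). [cite: Hintz2024GluingII, TeX l.2864 (computed)] -/
theorem Zvec_eq (m a r x : ℝ) (ζ : Fin 4 → ℝ) (hP : Px a r x ≠ 0) (hD : mu m a r ≠ 0) (hS : Sx x ≠ 0) :
    Zvec m a r x ζ = ZC m a r x ζ := by
  funext k
  fin_cases k <;> simp only [Zvec, ZC, gXinv, Fin.sum_univ_four, Fin.zero_eta, Fin.mk_one, Fin.reduceFinMk, Matrix.cons_val,
      Qsym00, Qsym01, Qsym02, Qsym03, Qsym10, Qsym11, Qsym12, Qsym13, Qsym20, Qsym21, Qsym22, Qsym23, Qsym30, Qsym31, Qsym32,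
      Qsym33, zero_mul, add_zero, zero_add] <;> field_simp <;> (try simp only [mu, Sx]) <;> ring

/-- Momentum derivative of a section that is LINEAR in the momenta, `e_ν = Σ_κ F_{νκ}ζ_κ`: `∂e_ν/∂ζ_k = F_{νk}`. [folklore] -/
theorem hasDerivAt_mulVec_update (F : Matrix (Fin 4) (Fin 4) ℝ) (ζ : Fin 4 → ℝ) (ν k : Fin 4) :
    HasDerivAt (fun t => (F.mulVec (Function.update ζ k t)) ν) (F ν k) (ζ k) := by
  fin_cases k <;>
  · simp only [Matrix.mulVec, dotProduct, Fin.sum_univ_four, Fin.isValue, Function.update_self, ne_eq, Fin.reduceEq,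
      not_false_eq_true, Function.update_of_ne, Fin.zero_eta, Fin.mk_one, Fin.reduceFinMk]
    first
    | exact ((((hasDerivAt_id' (x := ζ 0)).const_mul (F ν 0)).add_const _).add_const _).add_const _ |>.congr_deriv (by ring)
    | exact ((((hasDerivAt_id' (x := ζ 1)).const_mul (F ν 1)).const_add _).add_const _).add_const _ |>.congr_deriv (by ring)
    | exact (((hasDerivAt_id' (x := ζ 2)).const_mul (F ν 2)).const_add _).add_const _ |>.congr_deriv (by ring)
    | exact ((hasDerivAt_id' (x := ζ 3)).const_mul (F ν 3)).const_add _ |>.congr_deriv (by ring)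

/-- **The Hamiltonian vector field `H_{G_b} = Σ_k (∂G_b/∂ζ_k)∂_{x^k} − (∂_{x^k}G_b)∂_{ζ_k}`** (the convention of GII (EqGlDynKerrLocRestr),
TeX l.2679–2681, under which `π_*H_G = 2ζ♯`, l.2864) applied COMPONENTWISE to a section `e_ν = Σ_κ F_{νκ}(r,x)ζ_κ` of `π*T*𝓜°`
that is linear in the momenta with `𝔱,ϕ`-independent coefficients: `H_G(e_ν) = Z^r(∂_r F ζ)_ν + Z^x(∂_x F ζ)_ν − (∂_rG)F_{νr} − (∂_xG)F_{νx}`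
(`∂_𝔱G = ∂_ϕG = 0`; the arguments `Fr`, `Fx` are the certified `∂_r F`, `∂_x F` of §5). [cite: Hintz2024GluingII, Hamiltonian
vector field convention TeX l.2679-2681 and l.2864 (transcription)] -/
def HGsec (m a r x : ℝ) (ζ : Fin 4 → ℝ) (F Fr Fx : Matrix (Fin 4) (Fin 4) ℝ) (ν : Fin 4) : ℝ :=
  Zvec m a r x ζ 1 * (Fr.mulVec ζ) ν + Zvec m a r x ζ 2 * (Fx.mulVec ζ) ν
    - (dGr m a r x ζ * F ν 1 + dGx m a r x ζ * F ν 2)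

/-- The connection matrix along `H_G`: `Y_{νl} := Σ_k Γ^l_{kν} Z^k` (so that `Γ^l_{κν}(π_*H_G)^κ e_l = Σ_l Y_{νl}e_l`). [folklore] -/
def Ymat (m a r x : ℝ) (ζ : Fin 4 → ℝ) (ν l : Fin 4) : ℝ := ∑ k, Gam m a r x l k ν * Zvec m a r x ζ k

/-- **The pull-back connection `∇^{π*T*𝓜}` of the Levi-Civita connection along `H_{G_b}`** (GII (EqGlDynTrDb) `𝒟_b := ∇^{π*T*}_{H_{Ĝ_b}}`,
TeX l.2852-2855; H (6.16c)), on sections linear in the momenta, componentwise in the chart: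
`(∇_{H_G} e)_ν = H_G(e_ν) − Γ^l_{κν}(π_*H_G)^κ e_l`. [cite: Hintz2024GluingII, eq. (EqGlDynTrDb) TeX l.2852-2855 (transcription:
pull-back of the Levi-Civita connection, standard coordinate formula); Hintz2026, (6.16c) TeX l.6014-6018] -/
def nablaHG (m a r x : ℝ) (ζ : Fin 4 → ℝ) (F Fr Fx : Matrix (Fin 4) (Fin 4) ℝ) (ν : Fin 4) : ℝ :=
  HGsec m a r x ζ F Fr Fx ν - ∑ l, Ymat m a r x ζ ν l * (F.mulVec ζ) l

/-- Closed forms of `Y_{νl} = Σ_k Γ^l_{kν}Z^k`, row `ν = 0` (CAS-proposed, proved in `Ymat_eq`). [folklore] (computed) -/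
def YCrow0 (m a r x : ℝ) (ζ : Fin 4 → ℝ) : Fin 4 → ℝ :=
  ![-(2 * m * (a ^ 4 * x ^ 2 * ζ 1 + a ^ 2 * r ^ 2 * x ^ 2 * ζ 1 - a ^ 2 * r ^ 2 * ζ 1 + 2 * a ^ 2 * r * x ^ 3 * ζ 2 - 2 * a ^ 2 *
      r * x * ζ 2 - r ^ 4 * ζ 1) / Px a r x ^ 3),
    2 * m * (a ^ 4 * x ^ 2 * ζ 0 + a ^ 3 * x ^ 2 * ζ 3 + a ^ 2 * r ^ 2 * x ^ 2 * ζ 0 - a ^ 2 * r ^ 2 * ζ 0 - a * r ^ 2 * ζ 3 - r ^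
        4 * ζ 0) / Px a r x ^ 3,
    4 * m * a * r * x * (a * x ^ 2 * ζ 0 - a * ζ 0 - ζ 3) / Px a r x ^ 3,
    -(2 * m * a * (a ^ 2 * x ^ 2 * ζ 1 - r ^ 2 * ζ 1 - 2 * r * x * ζ 2) / Px a r x ^ 3)]

/-- Closed forms of `Y_{νl} = Σ_k Γ^l_{kν}Z^k`, row `ν = 1` (CAS-proposed, proved in `Ymat_eq`). [folklore] (computed) -/
def YCrow1 (m a r x : ℝ) (ζ : Fin 4 → ℝ) : Fin 4 → ℝ :=
  ![-(2 * m * (4 * m * a ^ 2 * r ^ 3 * x ^ 2 * ζ 0 - 4 * m * a ^ 2 * r ^ 3 * ζ 0 - 4 * m * a * r ^ 3 * ζ 3 - a ^ 6 * x ^ 2 * ζ 0 -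
      a ^ 5 * x ^ 2 * ζ 3 - 2 * a ^ 4 * r ^ 2 * x ^ 2 * ζ 0 + a ^ 4 * r ^ 2 * ζ 0 + a ^ 3 * r ^ 2 * x ^ 2 * ζ 3 + a ^ 3 * r ^ 2 *
      ζ 3 - a ^ 2 * r ^ 4 * x ^ 2 * ζ 0 + 2 * a ^ 2 * r ^ 4 * ζ 0 + 3 * a * r ^ 4 * ζ 3 + r ^ 6 * ζ 0) / (Px a r x ^ 2 * mu m a r
      ^ 2)),
    2 * (m * a ^ 2 * x ^ 2 * ζ 1 - m * r ^ 2 * ζ 1 - a ^ 2 * r * x ^ 2 * ζ 1 + a ^ 2 * r * ζ 1 - a ^ 2 * x ^ 3 * ζ 2 + a ^ 2 * x *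
        ζ 2) / Px a r x ^ 2,
    -(2 * Sx x * (a ^ 2 * x * ζ 1 - r * ζ 2) / Px a r x ^ 2),
    -(2 * (4 * m ^ 2 * a * r ^ 3 * x ^ 2 * ζ 0 - 4 * m ^ 2 * a * r ^ 3 * ζ 0 - 4 * m ^ 2 * r ^ 3 * ζ 3 + m * a ^ 5 * x ^ 4 * ζ 0 -
        m * a ^ 5 * x ^ 2 * ζ 0 + m * a ^ 4 * x ^ 4 * ζ 3 - m * a ^ 4 * x ^ 2 * ζ 3 - m * a ^ 3 * r ^ 2 * x ^ 4 * ζ 0 + m * a ^ 3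
        * r ^ 2 * ζ 0 + 3 * m * a ^ 2 * r ^ 2 * x ^ 2 * ζ 3 + m * a ^ 2 * r ^ 2 * ζ 3 - 3 * m * a * r ^ 4 * x ^ 2 * ζ 0 + 3 * m *
        a * r ^ 4 * ζ 0 + 4 * m * r ^ 4 * ζ 3 - a ^ 4 * r * x ^ 4 * ζ 3 - 2 * a ^ 2 * r ^ 3 * x ^ 2 * ζ 3 - r ^ 5 * ζ 3) / (Px a r
        x ^ 2 * mu m a r ^ 2 * Sx x))]

/-- Closed forms of `Y_{νl} = Σ_k Γ^l_{kν}Z^k`, row `ν = 2` (CAS-proposed, proved in `Ymat_eq`). [folklore] (computed) -/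
def YCrow2 (m a r x : ℝ) (ζ : Fin 4 → ℝ) : Fin 4 → ℝ :=
  ![-(4 * m * a ^ 2 * r * x * (a ^ 2 * ζ 0 + a * ζ 3 + r ^ 2 * ζ 0) / (Px a r x ^ 2 * mu m a r)),
    2 * mu m a r * (a ^ 2 * x * ζ 1 - r * ζ 2) / Px a r x ^ 2,
    -(2 * (2 * m * r ^ 2 * ζ 1 - a ^ 2 * r * ζ 1 - a ^ 2 * x * ζ 2 - r ^ 3 * ζ 1 - r ^ 2 * x * ζ 2) / Px a r x ^ 2),
    -(2 * x * (2 * m * a ^ 3 * r * x ^ 4 * ζ 0 - 4 * m * a ^ 3 * r * x ^ 2 * ζ 0 + 2 * m * a ^ 3 * r * ζ 0 - 4 * m * a ^ 2 * r * x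
        ^ 2 * ζ 3 + 2 * m * a ^ 2 * r * ζ 3 - 2 * m * r ^ 3 * ζ 3 + a ^ 4 * x ^ 4 * ζ 3 + 2 * a ^ 2 * r ^ 2 * x ^ 2 * ζ 3 + r ^ 4
        * ζ 3) / (Px a r x ^ 2 * mu m a r * Sx x ^ 2))]

/-- Closed forms of `Y_{νl} = Σ_k Γ^l_{kν}Z^k`, row `ν = 3` (CAS-proposed, proved in `Ymat_eq`). [folklore] (computed) -/
def YCrow3 (m a r x : ℝ) (ζ : Fin 4 → ℝ) : Fin 4 → ℝ :=
  ![2 * m * a * Sx x * (a ^ 4 * x ^ 2 * ζ 1 - a ^ 2 * r ^ 2 * x ^ 2 * ζ 1 - a ^ 2 * r ^ 2 * ζ 1 + 2 * a ^ 2 * r * x ^ 3 * ζ 2 - 2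
      * a ^ 2 * r * x * ζ 2 - 3 * r ^ 4 * ζ 1) / Px a r x ^ 3,
    2 * (m * a ^ 5 * x ^ 4 * ζ 0 - m * a ^ 5 * x ^ 2 * ζ 0 + m * a ^ 4 * x ^ 4 * ζ 3 - m * a ^ 4 * x ^ 2 * ζ 3 - m * a ^ 3 * r ^ 2
        * x ^ 4 * ζ 0 + m * a ^ 3 * r ^ 2 * ζ 0 + m * a ^ 2 * r ^ 2 * x ^ 2 * ζ 3 + m * a ^ 2 * r ^ 2 * ζ 3 - 3 * m * a * r ^ 4 *
        x ^ 2 * ζ 0 + 3 * m * a * r ^ 4 * ζ 0 + 2 * m * r ^ 4 * ζ 3 - a ^ 4 * r * x ^ 4 * ζ 3 - 2 * a ^ 2 * r ^ 3 * x ^ 2 * ζ 3 -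
        r ^ 5 * ζ 3) / Px a r x ^ 3,
    2 * x * (2 * m * a ^ 3 * r * x ^ 4 * ζ 0 - 4 * m * a ^ 3 * r * x ^ 2 * ζ 0 + 2 * m * a ^ 3 * r * ζ 0 - 2 * m * a ^ 2 * r * x ^
        2 * ζ 3 + 2 * m * a ^ 2 * r * ζ 3 + a ^ 4 * x ^ 4 * ζ 3 + 2 * a ^ 2 * r ^ 2 * x ^ 2 * ζ 3 + r ^ 4 * ζ 3) / Px a r x ^ 3,
    -(2 * (m * a ^ 4 * x ^ 4 * ζ 1 - m * a ^ 4 * x ^ 2 * ζ 1 + m * a ^ 2 * r ^ 2 * x ^ 2 * ζ 1 + m * a ^ 2 * r ^ 2 * ζ 1 - 2 * m *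
        a ^ 2 * r * x ^ 3 * ζ 2 + 2 * m * a ^ 2 * r * x * ζ 2 + 2 * m * r ^ 4 * ζ 1 - a ^ 4 * r * x ^ 4 * ζ 1 + a ^ 4 * x ^ 5 * ζ
        2 - 2 * a ^ 2 * r ^ 3 * x ^ 2 * ζ 1 + 2 * a ^ 2 * r ^ 2 * x ^ 3 * ζ 2 - r ^ 5 * ζ 1 + r ^ 4 * x * ζ 2) / Px a r x ^ 3)]

/-- Closed forms of `Y_{νl} = Σ_k Γ^l_{kν}Z^k` (rows `ν`, columns `l`). [folklore] (computed) -/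
def YC (m a r x : ℝ) (ζ : Fin 4 → ℝ) : Matrix (Fin 4) (Fin 4) ℝ :=
  Matrix.of ![YCrow0 m a r x ζ, YCrow1 m a r x ζ, YCrow2 m a r x ζ, YCrow3 m a r x ζ]

/-- `Y = YC` for ALL `(𝔪, a)` (`P, μ, S ≠ 0`). [folklore] (computed) -/
theorem Ymat_eq (m a r x : ℝ) (ζ : Fin 4 → ℝ) (hP : Px a r x ≠ 0) (hD : mu m a r ≠ 0) (hS : Sx x ≠ 0) (ν l : Fin 4) :
    Ymat m a r x ζ ν l = YC m a r x ζ ν l := by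
  have hG := Gam_eq m a r x hP hD hS
  have hZ := Zvec_eq m a r x ζ hP hD hS
  fin_cases ν <;> fin_cases l <;>
    simp only [Ymat, hG, GamC, hZ, ZC, YC, YCrow0, YCrow1, YCrow2, YCrow3, Fin.sum_univ_four, Fin.zero_eta, Fin.mk_one,
        Fin.reduceFinMk, Matrix.cons_val, Matrix.of_apply, Qsym00, Qsym01, Qsym02, Qsym03, Qsym10, Qsym11, Qsym12, Qsym13, Qsym20,
        Qsym21, Qsym22, Qsym23, Qsym30, Qsym31, Qsym32, Qsym33, zero_mul, add_zero, zero_add] <;>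
    field_simp <;> (try simp only [Px, mu, Sx]) <;> ring

/-! ## 5. The frame `e⁰, e¹, e², e³` (H l.5999–6002; GII (EqGlDynTre03)/(EqGlDynTre12)) in the coframe `(d𝔱, dr, dx, dϕ)`

In the x-chart each `e^μ` is LINEAR in `ζ` with coefficients rational in `(r, x)`: the square roots `√μ`, `ϱ`, `sin θ` of the
tetrad (6.15) occur in `e^μ = Σ_κ (coefficient)·ζ(ω_(κ))·ω^(λ)` only through the products `ζ(ω_(κ))ω^(λ)` with
`(κ,λ) ∈ {(0,1),(1,0),(2,3),(3,2),(0,0),(1,1),(2,2),(3,3)}`, which are rational; the transcription is checked against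
(6.16a) in `gram_xchart` and against GII Remark 3.22 in §8.  We write
`e^μ_ν = Σ_κ F^μ_{νκ} ζ_κ` with explicit matrices `F1, F2, F3` (`e⁰ = ζ`: `F⁰ = 1`). -/

/-- `(4×4 literal)·ζ` evaluated. [folklore] -/
theorem mulVec4 (q00 q01 q02 q03 q10 q11 q12 q13 q20 q21 q22 q23 q30 q31 q32 q33 : ℝ) (ζ : Fin 4 → ℝ) :
    (!![q00, q01, q02, q03; q10, q11, q12, q13; q20, q21, q22, q23; q30, q31, q32, q33] :
        Matrix (Fin 4) (Fin 4) ℝ).mulVec ζ =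
      ![q00 * ζ 0 + q01 * ζ 1 + q02 * ζ 2 + q03 * ζ 3, q10 * ζ 0 + q11 * ζ 1 + q12 * ζ 2 + q13 * ζ 3,
        q20 * ζ 0 + q21 * ζ 1 + q22 * ζ 2 + q23 * ζ 3, q30 * ζ 0 + q31 * ζ 1 + q32 * ζ 2 + q33 * ζ 3] := by
  ext i; fin_cases i <;> simp [Matrix.mulVec, dotProduct, Fin.sum_univ_four]

/-- Component `0` of a `4`-vector literal. [folklore] -/
theorem vec4_0 (u0 u1 u2 u3 : ℝ) : (![u0, u1, u2, u3] : Fin 4 → ℝ) 0 = u0 := rfl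

/-- Component `1` of a `4`-vector literal. [folklore] -/
theorem vec4_1 (u0 u1 u2 u3 : ℝ) : (![u0, u1, u2, u3] : Fin 4 → ℝ) 1 = u1 := rfl

/-- Component `2` of a `4`-vector literal. [folklore] -/
theorem vec4_2 (u0 u1 u2 u3 : ℝ) : (![u0, u1, u2, u3] : Fin 4 → ℝ) 2 = u2 := rfl

/-- Component `3` of a `4`-vector literal. [folklore] -/
theorem vec4_3 (u0 u1 u2 u3 : ℝ) : (![u0, u1, u2, u3] : Fin 4 → ℝ) 3 = u3 := rfl

/-- `e¹ := (rω_(1), rω_(0), −a cosθ ω_(3), a cosθ ω_(2))` (coefficients in the tetrad) written out in the coframe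
`(d𝔱,dr,dx,dϕ)`: rows `e¹_𝔱 = (rμξ − a²xSζ_x)/P`, `e¹_r = r((r²+a²)ζ_𝔱 + aζ_ϕ)/μ`, `e¹_x = −a²xζ_𝔱 − axζ_ϕ/S`, `e¹_ϕ = (−raSμξ +
ax(r²+a²)Sζ_x)/P` (so `w₀ = (r²+a²)ζ_𝔱 + aζ_ϕ = −(r²+a²)σ + aη_ϕ`, `w₃ = −(aSζ_𝔱 + ζ_ϕ) = aSσ − η_ϕ`). [cite: Hintz2026, frame
display TeX l.5999-6002 (transcription into the x = cos θ coframe); Hintz2024GluingII, (EqGlDynTre12) TeX l.2915-2918] -/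
def F1 (m a r x : ℝ) : Matrix (Fin 4) (Fin 4) ℝ :=
  !![0, r * mu m a r / Px a r x, -(a ^ 2 * x * Sx x / Px a r x), 0; r * (r ^ 2 + a ^ 2) / mu m a r, 0, 0, r * a / mu m a r; -(a ^
      2 * x), 0, 0, -(a * x / Sx x); 0, -(r * a * Sx x * mu m a r / Px a r x), a * x * (r ^ 2 + a ^ 2) * Sx x / Px a r x, 0]

/-- `e² := (ϱ²/2)(ω_(0), ω_(1), −ω_(2), −ω_(3))` in the coframe `(d𝔱,dr,dx,dϕ)`: `e²_𝔱 = (w₀ − aw₃)/2`, `e²_r = Pξ/2`, `e²_x =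
−Pζ_x/2`, `e²_ϕ = (−aSw₀ + (r²+a²)w₃)/2`. [cite: Hintz2026, frame display TeX l.5999-6002 (transcription into the x = cos θ
coframe); Hintz2024GluingII, (EqGlDynTre12) TeX l.2915-2918] -/
def F2 (a r x : ℝ) : Matrix (Fin 4) (Fin 4) ℝ :=
  !![(r ^ 2 + a ^ 2 + a ^ 2 * Sx x) / 2, 0, 0, a; 0, Px a r x / 2, 0, 0; 0, 0, -(Px a r x / 2), 0; -(a * Sx x * (r ^ 2 + a ^ 2)),
      0, 0, -((a ^ 2 * Sx x + (r ^ 2 + a ^ 2)) / 2)]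

/-- `e³ := (a cosθ ω_(1), a cosθ ω_(0), rω_(3), −rω_(2)) = KY(ζ)` in the coframe `(d𝔱,dr,dx,dϕ)`: `e³_𝔱 = (axμξ + raSζ_x)/P`,
`e³_r = axw₀/μ`, `e³_x = −rw₃/S`, `e³_ϕ = (−a²xSμξ − r(r²+a²)Sζ_x)/P`. [cite: Hintz2026, frame display TeX l.5999-6002
(transcription); Hintz2024GluingII, (EqGlDynTre03) TeX l.2904-2912] -/
def F3 (m a r x : ℝ) : Matrix (Fin 4) (Fin 4) ℝ :=
  !![0, a * x * mu m a r / Px a r x, r * a * Sx x / Px a r x, 0; a * x * (r ^ 2 + a ^ 2) / mu m a r, 0, 0, a ^ 2 * x / mu m a r; r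
      * a, 0, 0, r / Sx x; 0, -(a ^ 2 * x * Sx x * mu m a r / Px a r x), -(r * (r ^ 2 + a ^ 2) * Sx x / Px a r x), 0]

/-- `∂_r` of the `e¹` coefficients. [cite: Hintz2026, TeX l.5999-6002 (computed)] -/
def F1r (m a r x : ℝ) : Matrix (Fin 4) (Fin 4) ℝ :=
  !![0, ((mu m a r + r * (2 * r - 2 * m)) * Px a r x - r * mu m a r * (2 * r)) / Px a r x ^ 2, a ^ 2 * x * Sx x * (2 * r) / Px a r
      x ^ 2, 0;
    ((r ^ 2 + a ^ 2 + r * (2 * r)) * mu m a r - r * (r ^ 2 + a ^ 2) * (2 * r - 2 * m)) / mu m a r ^ 2, 0, 0, (a * mu m a r - r * a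
        * (2 * r - 2 * m)) / mu m a r ^ 2;
    0, 0, 0, 0;
    0, -(((a * Sx x * mu m a r + r * a * Sx x * (2 * r - 2 * m)) * Px a r x - r * a * Sx x * mu m a r * (2 * r)) / Px a r x ^ 2),
        (a * x * (2 * r) * Sx x * Px a r x - a * x * (r ^ 2 + a ^ 2) * Sx x * (2 * r)) / Px a r x ^ 2, 0]

/-- **`∂_r e¹` certified** (row by row, as a function of `r` with `ζ` fixed). [cite: Hintz2026, TeX l.5999-6002 (computed)] -/
theorem hasDerivAt_F1_r (m a r x : ℝ) (ζ : Fin 4 → ℝ) (hP : Px a r x ≠ 0) (hD : mu m a r ≠ 0) (ν : Fin 4) :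
    HasDerivAt (fun r' => ((F1 m a r' x).mulVec ζ) ν) (((F1r m a r x).mulVec ζ) ν) r := by
  fin_cases ν
  · simp only [F1, F1r, mulVec4, Fin.zero_eta, vec4_0]
    exact (((((hasDerivAt_const r (0 : ℝ)).fun_mul (hasDerivAt_const r (ζ 0))).fun_add ((((hasDerivAt_id' (x := r)).fun_mul
        (hasDerivAt_mu_r m a r)).fun_div (hasDerivAt_Px_r a r x) hP).fun_mul (hasDerivAt_const r (ζ 1)))).fun_add
        ((((hasDerivAt_const r (a ^ 2 * x * Sx x : ℝ)).fun_div (hasDerivAt_Px_r a r x) hP).fun_neg).fun_mul (hasDerivAt_const r (ζ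
        2)))).fun_add ((hasDerivAt_const r (0 : ℝ)).fun_mul (hasDerivAt_const r (ζ 3)))).congr_deriv (by ring)
  · simp only [F1, F1r, mulVec4, Fin.mk_one, vec4_1]
    exact (((((((hasDerivAt_id' (x := r)).fun_mul (((hasDerivAt_id' (x := r)).fun_pow 2).fun_add (hasDerivAt_const r (a ^ 2 :
        ℝ)))).fun_div (hasDerivAt_mu_r m a r) hD).fun_mul (hasDerivAt_const r (ζ 0))).fun_add ((hasDerivAt_const r (0 :
        ℝ)).fun_mul (hasDerivAt_const r (ζ 1)))).fun_add ((hasDerivAt_const r (0 : ℝ)).fun_mul (hasDerivAt_const r (ζ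
        2)))).fun_add ((((hasDerivAt_id' (x := r)).fun_mul (hasDerivAt_const r (a : ℝ))).fun_div (hasDerivAt_mu_r m a r)
        hD).fun_mul (hasDerivAt_const r (ζ 3)))).congr_deriv (by ring)
  · simp only [F1, F1r, mulVec4, Fin.reduceFinMk, vec4_2]
    exact (((((hasDerivAt_const r (-(a ^ 2 * x) : ℝ)).fun_mul (hasDerivAt_const r (ζ 0))).fun_add ((hasDerivAt_const r (0 :
        ℝ)).fun_mul (hasDerivAt_const r (ζ 1)))).fun_add ((hasDerivAt_const r (0 : ℝ)).fun_mul (hasDerivAt_const r (ζ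
        2)))).fun_add ((hasDerivAt_const r (-(a * x / Sx x) : ℝ)).fun_mul (hasDerivAt_const r (ζ 3)))).congr_deriv (by ring)
  · simp only [F1, F1r, mulVec4, Fin.reduceFinMk, vec4_3]
    exact (((((hasDerivAt_const r (0 : ℝ)).fun_mul (hasDerivAt_const r (ζ 0))).fun_add (((((((hasDerivAt_id' (x := r)).fun_mul
        (hasDerivAt_const r (a : ℝ))).fun_mul (hasDerivAt_const r (Sx x : ℝ))).fun_mul (hasDerivAt_mu_r m a r)).fun_div
        (hasDerivAt_Px_r a r x) hP).fun_neg).fun_mul (hasDerivAt_const r (ζ 1)))).fun_add (((((hasDerivAt_const r (a * x :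
        ℝ)).fun_mul (((hasDerivAt_id' (x := r)).fun_pow 2).fun_add (hasDerivAt_const r (a ^ 2 : ℝ)))).fun_mul (hasDerivAt_const r
        (Sx x : ℝ))).fun_div (hasDerivAt_Px_r a r x) hP).fun_mul (hasDerivAt_const r (ζ 2)))).fun_add ((hasDerivAt_const r (0 :
        ℝ)).fun_mul (hasDerivAt_const r (ζ 3)))).congr_deriv (by ring)

/-- `∂_x` of the `e¹` coefficients. [cite: Hintz2026, TeX l.5999-6002 (computed)] -/
def F1x (m a r x : ℝ) : Matrix (Fin 4) (Fin 4) ℝ :=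
  !![0, -(r * mu m a r * (2 * a ^ 2 * x) / Px a r x ^ 2), -(((a ^ 2 * Sx x - a ^ 2 * x * (2 * x)) * Px a r x - a ^ 2 * x * Sx x *
      (2 * a ^ 2 * x)) / Px a r x ^ 2), 0;
    0, 0, 0, 0;
    -(a ^ 2), 0, 0, -((a * Sx x + a * x * (2 * x)) / Sx x ^ 2);
    0, -(((-(r * a * (2 * x) * mu m a r * Px a r x)) - r * a * Sx x * mu m a r * (2 * a ^ 2 * x)) / Px a r x ^ 2), ((a * (r ^ 2 +
        a ^ 2) * Sx x - a * x * (r ^ 2 + a ^ 2) * (2 * x)) * Px a r x - a * x * (r ^ 2 + a ^ 2) * Sx x * (2 * a ^ 2 * x)) / Px a r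
        x ^ 2, 0]

/-- **`∂_x e¹` certified.** [cite: Hintz2026, TeX l.5999-6002 (computed)] -/
theorem hasDerivAt_F1_x (m a r x : ℝ) (ζ : Fin 4 → ℝ) (hP : Px a r x ≠ 0) (hS : Sx x ≠ 0) (ν : Fin 4) :
    HasDerivAt (fun x' => ((F1 m a r x').mulVec ζ) ν) (((F1x m a r x).mulVec ζ) ν) x := by
  fin_cases ν
  · simp only [F1, F1x, mulVec4, Fin.zero_eta, vec4_0]
    exact (((((hasDerivAt_const x (0 : ℝ)).fun_mul (hasDerivAt_const x (ζ 0))).fun_add (((hasDerivAt_const x (r * mu m a r :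
        ℝ)).fun_div (hasDerivAt_Px_x a r x) hP).fun_mul (hasDerivAt_const x (ζ 1)))).fun_add ((((((hasDerivAt_const x (a ^ 2 :
        ℝ)).fun_mul (hasDerivAt_id' (x := x))).fun_mul (hasDerivAt_Sx x)).fun_div (hasDerivAt_Px_x a r x) hP).fun_neg).fun_mul
        (hasDerivAt_const x (ζ 2)))).fun_add ((hasDerivAt_const x (0 : ℝ)).fun_mul (hasDerivAt_const x (ζ 3)))).congr_deriv (by
        ring)
  · simp only [F1, F1x, mulVec4, Fin.mk_one, vec4_1]
    exact (((((hasDerivAt_const x (r * (r ^ 2 + a ^ 2) / mu m a r : ℝ)).fun_mul (hasDerivAt_const x (ζ 0))).fun_add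
        ((hasDerivAt_const x (0 : ℝ)).fun_mul (hasDerivAt_const x (ζ 1)))).fun_add ((hasDerivAt_const x (0 : ℝ)).fun_mul
        (hasDerivAt_const x (ζ 2)))).fun_add ((hasDerivAt_const x (r * a / mu m a r : ℝ)).fun_mul (hasDerivAt_const x (ζ
        3)))).congr_deriv (by ring)
  · simp only [F1, F1x, mulVec4, Fin.reduceFinMk, vec4_2]
    exact (((((((hasDerivAt_const x (a ^ 2 : ℝ)).fun_mul (hasDerivAt_id' (x := x))).fun_neg).fun_mul (hasDerivAt_const x (ζ
        0))).fun_add ((hasDerivAt_const x (0 : ℝ)).fun_mul (hasDerivAt_const x (ζ 1)))).fun_add ((hasDerivAt_const x (0 :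
        ℝ)).fun_mul (hasDerivAt_const x (ζ 2)))).fun_add (((((hasDerivAt_const x (a : ℝ)).fun_mul (hasDerivAt_id' (x :=
        x))).fun_div (hasDerivAt_Sx x) hS).fun_neg).fun_mul (hasDerivAt_const x (ζ 3)))).congr_deriv (by ring)
  · simp only [F1, F1x, mulVec4, Fin.reduceFinMk, vec4_3]
    exact (((((hasDerivAt_const x (0 : ℝ)).fun_mul (hasDerivAt_const x (ζ 0))).fun_add ((((((hasDerivAt_const x (r * a :
        ℝ)).fun_mul (hasDerivAt_Sx x)).fun_mul (hasDerivAt_const x (mu m a r : ℝ))).fun_div (hasDerivAt_Px_x a r x)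
        hP).fun_neg).fun_mul (hasDerivAt_const x (ζ 1)))).fun_add ((((((hasDerivAt_const x (a : ℝ)).fun_mul (hasDerivAt_id' (x :=
        x))).fun_mul (hasDerivAt_const x (r ^ 2 + a ^ 2 : ℝ))).fun_mul (hasDerivAt_Sx x)).fun_div (hasDerivAt_Px_x a r x)
        hP).fun_mul (hasDerivAt_const x (ζ 2)))).fun_add ((hasDerivAt_const x (0 : ℝ)).fun_mul (hasDerivAt_const x (ζ
        3)))).congr_deriv (by ring)

/-- `∂_r` of the `e²` coefficients. [cite: Hintz2026, TeX l.5999-6002 (computed)] -/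
def F2r (a r x : ℝ) : Matrix (Fin 4) (Fin 4) ℝ :=
  !![2 * (2 * r) / 4, 0, 0, 0;
    0, 2 * (2 * r) / 4, 0, 0;
    0, 0, -(2 * (2 * r) / 4), 0;
    -(a * Sx x * (2 * r)), 0, 0, -(2 * (2 * r) / 4)]

/-- **`∂_r e²` certified.** [cite: Hintz2026, TeX l.5999-6002 (computed)] -/
theorem hasDerivAt_F2_r (a r x : ℝ) (ζ : Fin 4 → ℝ)  (ν : Fin 4) :
    HasDerivAt (fun r' => ((F2 a r' x).mulVec ζ) ν) (((F2r a r x).mulVec ζ) ν) r := by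
  fin_cases ν
  · simp only [F2, F2r, mulVec4, Fin.zero_eta, vec4_0]
    exact (((((((((hasDerivAt_id' (x := r)).fun_pow 2).fun_add (hasDerivAt_const r (a ^ 2 : ℝ))).fun_add (hasDerivAt_const r (a ^
        2 * Sx x : ℝ))).fun_div (hasDerivAt_const r (2 : ℝ)) (by norm_num)).fun_mul (hasDerivAt_const r (ζ 0))).fun_add
        ((hasDerivAt_const r (0 : ℝ)).fun_mul (hasDerivAt_const r (ζ 1)))).fun_add ((hasDerivAt_const r (0 : ℝ)).fun_mul
        (hasDerivAt_const r (ζ 2)))).fun_add ((hasDerivAt_const r (a : ℝ)).fun_mul (hasDerivAt_const r (ζ 3)))).congr_deriv (by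
        ring)
  · simp only [F2, F2r, mulVec4, Fin.mk_one, vec4_1]
    exact (((((hasDerivAt_const r (0 : ℝ)).fun_mul (hasDerivAt_const r (ζ 0))).fun_add (((hasDerivAt_Px_r a r x).fun_div
        (hasDerivAt_const r (2 : ℝ)) (by norm_num)).fun_mul (hasDerivAt_const r (ζ 1)))).fun_add ((hasDerivAt_const r (0 :
        ℝ)).fun_mul (hasDerivAt_const r (ζ 2)))).fun_add ((hasDerivAt_const r (0 : ℝ)).fun_mul (hasDerivAt_const r (ζ
        3)))).congr_deriv (by ring)
  · simp only [F2, F2r, mulVec4, Fin.reduceFinMk, vec4_2]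
    exact (((((hasDerivAt_const r (0 : ℝ)).fun_mul (hasDerivAt_const r (ζ 0))).fun_add ((hasDerivAt_const r (0 : ℝ)).fun_mul
        (hasDerivAt_const r (ζ 1)))).fun_add ((((hasDerivAt_Px_r a r x).fun_div (hasDerivAt_const r (2 : ℝ)) (by
        norm_num)).fun_neg).fun_mul (hasDerivAt_const r (ζ 2)))).fun_add ((hasDerivAt_const r (0 : ℝ)).fun_mul (hasDerivAt_const r
        (ζ 3)))).congr_deriv (by ring)
  · simp only [F2, F2r, mulVec4, Fin.reduceFinMk, vec4_3]
    exact (((((((hasDerivAt_const r (a * Sx x : ℝ)).fun_mul (((hasDerivAt_id' (x := r)).fun_pow 2).fun_add (hasDerivAt_const r (a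
        ^ 2 : ℝ)))).fun_neg).fun_mul (hasDerivAt_const r (ζ 0))).fun_add ((hasDerivAt_const r (0 : ℝ)).fun_mul (hasDerivAt_const r
        (ζ 1)))).fun_add ((hasDerivAt_const r (0 : ℝ)).fun_mul (hasDerivAt_const r (ζ 2)))).fun_add (((((hasDerivAt_const r (a ^ 2
        * Sx x : ℝ)).fun_add (((hasDerivAt_id' (x := r)).fun_pow 2).fun_add (hasDerivAt_const r (a ^ 2 : ℝ)))).fun_div
        (hasDerivAt_const r (2 : ℝ)) (by norm_num)).fun_neg).fun_mul (hasDerivAt_const r (ζ 3)))).congr_deriv (by ring)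

/-- `∂_x` of the `e²` coefficients. [cite: Hintz2026, TeX l.5999-6002 (computed)] -/
def F2x (a r x : ℝ) : Matrix (Fin 4) (Fin 4) ℝ :=
  !![2 * (-(a ^ 2 * (2 * x))) / 4, 0, 0, 0;
    0, 2 * (2 * a ^ 2 * x) / 4, 0, 0;
    0, 0, -(2 * (2 * a ^ 2 * x) / 4), 0;
    a * (2 * x) * (r ^ 2 + a ^ 2), 0, 0, -(2 * (-(a ^ 2 * (2 * x))) / 4)]

/-- **`∂_x e²` certified.** [cite: Hintz2026, TeX l.5999-6002 (computed)] -/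
theorem hasDerivAt_F2_x (a r x : ℝ) (ζ : Fin 4 → ℝ)  (ν : Fin 4) :
    HasDerivAt (fun x' => ((F2 a r x').mulVec ζ) ν) (((F2x a r x).mulVec ζ) ν) x := by
  fin_cases ν
  · simp only [F2, F2x, mulVec4, Fin.zero_eta, vec4_0]
    exact (((((((hasDerivAt_const x (r ^ 2 + a ^ 2 : ℝ)).fun_add ((hasDerivAt_const x (a ^ 2 : ℝ)).fun_mul (hasDerivAt_Sx
        x))).fun_div (hasDerivAt_const x (2 : ℝ)) (by norm_num)).fun_mul (hasDerivAt_const x (ζ 0))).fun_add ((hasDerivAt_const x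
        (0 : ℝ)).fun_mul (hasDerivAt_const x (ζ 1)))).fun_add ((hasDerivAt_const x (0 : ℝ)).fun_mul (hasDerivAt_const x (ζ
        2)))).fun_add ((hasDerivAt_const x (a : ℝ)).fun_mul (hasDerivAt_const x (ζ 3)))).congr_deriv (by ring)
  · simp only [F2, F2x, mulVec4, Fin.mk_one, vec4_1]
    exact (((((hasDerivAt_const x (0 : ℝ)).fun_mul (hasDerivAt_const x (ζ 0))).fun_add (((hasDerivAt_Px_x a r x).fun_div
        (hasDerivAt_const x (2 : ℝ)) (by norm_num)).fun_mul (hasDerivAt_const x (ζ 1)))).fun_add ((hasDerivAt_const x (0 :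
        ℝ)).fun_mul (hasDerivAt_const x (ζ 2)))).fun_add ((hasDerivAt_const x (0 : ℝ)).fun_mul (hasDerivAt_const x (ζ
        3)))).congr_deriv (by ring)
  · simp only [F2, F2x, mulVec4, Fin.reduceFinMk, vec4_2]
    exact (((((hasDerivAt_const x (0 : ℝ)).fun_mul (hasDerivAt_const x (ζ 0))).fun_add ((hasDerivAt_const x (0 : ℝ)).fun_mul
        (hasDerivAt_const x (ζ 1)))).fun_add ((((hasDerivAt_Px_x a r x).fun_div (hasDerivAt_const x (2 : ℝ)) (by
        norm_num)).fun_neg).fun_mul (hasDerivAt_const x (ζ 2)))).fun_add ((hasDerivAt_const x (0 : ℝ)).fun_mul (hasDerivAt_const x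
        (ζ 3)))).congr_deriv (by ring)
  · simp only [F2, F2x, mulVec4, Fin.reduceFinMk, vec4_3]
    exact ((((((((hasDerivAt_const x (a : ℝ)).fun_mul (hasDerivAt_Sx x)).fun_mul (hasDerivAt_const x (r ^ 2 + a ^ 2 :
        ℝ))).fun_neg).fun_mul (hasDerivAt_const x (ζ 0))).fun_add ((hasDerivAt_const x (0 : ℝ)).fun_mul (hasDerivAt_const x (ζ
        1)))).fun_add ((hasDerivAt_const x (0 : ℝ)).fun_mul (hasDerivAt_const x (ζ 2)))).fun_add ((((((hasDerivAt_const x (a ^ 2 :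
        ℝ)).fun_mul (hasDerivAt_Sx x)).fun_add (hasDerivAt_const x (r ^ 2 + a ^ 2 : ℝ))).fun_div (hasDerivAt_const x (2 : ℝ)) (by
        norm_num)).fun_neg).fun_mul (hasDerivAt_const x (ζ 3)))).congr_deriv (by ring)

/-- `∂_r` of the `e³` coefficients. [cite: Hintz2026, TeX l.5999-6002 (computed)] -/
def F3r (m a r x : ℝ) : Matrix (Fin 4) (Fin 4) ℝ :=
  !![0, (a * x * (2 * r - 2 * m) * Px a r x - a * x * mu m a r * (2 * r)) / Px a r x ^ 2, (a * Sx x * Px a r x - r * a * Sx x * (2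
      * r)) / Px a r x ^ 2, 0;
    (a * x * (2 * r) * mu m a r - a * x * (r ^ 2 + a ^ 2) * (2 * r - 2 * m)) / mu m a r ^ 2, 0, 0, -(a ^ 2 * x * (2 * r - 2 * m) /
        mu m a r ^ 2);
    a, 0, 0, Sx x / Sx x ^ 2;
    0, -((a ^ 2 * x * Sx x * (2 * r - 2 * m) * Px a r x - a ^ 2 * x * Sx x * mu m a r * (2 * r)) / Px a r x ^ 2), -(((r ^ 2 + a ^
        2 + r * (2 * r)) * Sx x * Px a r x - r * (r ^ 2 + a ^ 2) * Sx x * (2 * r)) / Px a r x ^ 2), 0]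

/-- **`∂_r e³` certified.** [cite: Hintz2026, TeX l.5999-6002 (computed)] -/
theorem hasDerivAt_F3_r (m a r x : ℝ) (ζ : Fin 4 → ℝ) (hP : Px a r x ≠ 0) (hD : mu m a r ≠ 0) (hS : Sx x ≠ 0) (ν : Fin 4) :
    HasDerivAt (fun r' => ((F3 m a r' x).mulVec ζ) ν) (((F3r m a r x).mulVec ζ) ν) r := by
  fin_cases ν
  · simp only [F3, F3r, mulVec4, Fin.zero_eta, vec4_0]
    exact (((((hasDerivAt_const r (0 : ℝ)).fun_mul (hasDerivAt_const r (ζ 0))).fun_add ((((hasDerivAt_const r (a * x : ℝ)).fun_mul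
        (hasDerivAt_mu_r m a r)).fun_div (hasDerivAt_Px_r a r x) hP).fun_mul (hasDerivAt_const r (ζ 1)))).fun_add
        (((((hasDerivAt_id' (x := r)).fun_mul (hasDerivAt_const r (a : ℝ))).fun_mul (hasDerivAt_const r (Sx x : ℝ))).fun_div
        (hasDerivAt_Px_r a r x) hP).fun_mul (hasDerivAt_const r (ζ 2)))).fun_add ((hasDerivAt_const r (0 : ℝ)).fun_mul
        (hasDerivAt_const r (ζ 3)))).congr_deriv (by ring)
  · simp only [F3, F3r, mulVec4, Fin.mk_one, vec4_1]
    exact (((((((hasDerivAt_const r (a * x : ℝ)).fun_mul (((hasDerivAt_id' (x := r)).fun_pow 2).fun_add (hasDerivAt_const r (a ^ 2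
        : ℝ)))).fun_div (hasDerivAt_mu_r m a r) hD).fun_mul (hasDerivAt_const r (ζ 0))).fun_add ((hasDerivAt_const r (0 :
        ℝ)).fun_mul (hasDerivAt_const r (ζ 1)))).fun_add ((hasDerivAt_const r (0 : ℝ)).fun_mul (hasDerivAt_const r (ζ
        2)))).fun_add (((hasDerivAt_const r (a ^ 2 * x : ℝ)).fun_div (hasDerivAt_mu_r m a r) hD).fun_mul (hasDerivAt_const r (ζ
        3)))).congr_deriv (by ring)
  · simp only [F3, F3r, mulVec4, Fin.reduceFinMk, vec4_2]
    exact ((((((hasDerivAt_id' (x := r)).fun_mul (hasDerivAt_const r (a : ℝ))).fun_mul (hasDerivAt_const r (ζ 0))).fun_add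
        ((hasDerivAt_const r (0 : ℝ)).fun_mul (hasDerivAt_const r (ζ 1)))).fun_add ((hasDerivAt_const r (0 : ℝ)).fun_mul
        (hasDerivAt_const r (ζ 2)))).fun_add (((hasDerivAt_id' (x := r)).fun_div (hasDerivAt_const r (Sx x : ℝ)) hS).fun_mul
        (hasDerivAt_const r (ζ 3)))).congr_deriv (by ring)
  · simp only [F3, F3r, mulVec4, Fin.reduceFinMk, vec4_3]
    exact (((((hasDerivAt_const r (0 : ℝ)).fun_mul (hasDerivAt_const r (ζ 0))).fun_add (((((hasDerivAt_const r (a ^ 2 * x * Sx x :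
        ℝ)).fun_mul (hasDerivAt_mu_r m a r)).fun_div (hasDerivAt_Px_r a r x) hP).fun_neg).fun_mul (hasDerivAt_const r (ζ
        1)))).fun_add ((((((hasDerivAt_id' (x := r)).fun_mul (((hasDerivAt_id' (x := r)).fun_pow 2).fun_add (hasDerivAt_const r (a
        ^ 2 : ℝ)))).fun_mul (hasDerivAt_const r (Sx x : ℝ))).fun_div (hasDerivAt_Px_r a r x) hP).fun_neg).fun_mul
        (hasDerivAt_const r (ζ 2)))).fun_add ((hasDerivAt_const r (0 : ℝ)).fun_mul (hasDerivAt_const r (ζ 3)))).congr_deriv (by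
        ring)

/-- `∂_x` of the `e³` coefficients. [cite: Hintz2026, TeX l.5999-6002 (computed)] -/
def F3x (m a r x : ℝ) : Matrix (Fin 4) (Fin 4) ℝ :=
  !![0, (a * mu m a r * Px a r x - a * x * mu m a r * (2 * a ^ 2 * x)) / Px a r x ^ 2, ((-(r * a * (2 * x) * Px a r x)) - r * a *
      Sx x * (2 * a ^ 2 * x)) / Px a r x ^ 2, 0;
    a * (r ^ 2 + a ^ 2) * mu m a r / mu m a r ^ 2, 0, 0, a ^ 2 * mu m a r / mu m a r ^ 2;
    0, 0, 0, r * (2 * x) / Sx x ^ 2;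
    0, -(((a ^ 2 * Sx x - a ^ 2 * x * (2 * x)) * mu m a r * Px a r x - a ^ 2 * x * Sx x * mu m a r * (2 * a ^ 2 * x)) / Px a r x ^
        2), -(((-(r * (r ^ 2 + a ^ 2) * (2 * x) * Px a r x)) - r * (r ^ 2 + a ^ 2) * Sx x * (2 * a ^ 2 * x)) / Px a r x ^ 2), 0]

/-- **`∂_x e³` certified.** [cite: Hintz2026, TeX l.5999-6002 (computed)] -/
theorem hasDerivAt_F3_x (m a r x : ℝ) (ζ : Fin 4 → ℝ) (hP : Px a r x ≠ 0) (hD : mu m a r ≠ 0) (hS : Sx x ≠ 0) (ν : Fin 4) :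
    HasDerivAt (fun x' => ((F3 m a r x').mulVec ζ) ν) (((F3x m a r x).mulVec ζ) ν) x := by
  fin_cases ν
  · simp only [F3, F3x, mulVec4, Fin.zero_eta, vec4_0]
    exact (((((hasDerivAt_const x (0 : ℝ)).fun_mul (hasDerivAt_const x (ζ 0))).fun_add (((((hasDerivAt_const x (a : ℝ)).fun_mul
        (hasDerivAt_id' (x := x))).fun_mul (hasDerivAt_const x (mu m a r : ℝ))).fun_div (hasDerivAt_Px_x a r x) hP).fun_mul
        (hasDerivAt_const x (ζ 1)))).fun_add ((((hasDerivAt_const x (r * a : ℝ)).fun_mul (hasDerivAt_Sx x)).fun_div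
        (hasDerivAt_Px_x a r x) hP).fun_mul (hasDerivAt_const x (ζ 2)))).fun_add ((hasDerivAt_const x (0 : ℝ)).fun_mul
        (hasDerivAt_const x (ζ 3)))).congr_deriv (by ring)
  · simp only [F3, F3x, mulVec4, Fin.mk_one, vec4_1]
    exact ((((((((hasDerivAt_const x (a : ℝ)).fun_mul (hasDerivAt_id' (x := x))).fun_mul (hasDerivAt_const x (r ^ 2 + a ^ 2 :
        ℝ))).fun_div (hasDerivAt_const x (mu m a r : ℝ)) hD).fun_mul (hasDerivAt_const x (ζ 0))).fun_add ((hasDerivAt_const x (0 :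
        ℝ)).fun_mul (hasDerivAt_const x (ζ 1)))).fun_add ((hasDerivAt_const x (0 : ℝ)).fun_mul (hasDerivAt_const x (ζ
        2)))).fun_add ((((hasDerivAt_const x (a ^ 2 : ℝ)).fun_mul (hasDerivAt_id' (x := x))).fun_div (hasDerivAt_const x (mu m a r
        : ℝ)) hD).fun_mul (hasDerivAt_const x (ζ 3)))).congr_deriv (by ring)
  · simp only [F3, F3x, mulVec4, Fin.reduceFinMk, vec4_2]
    exact (((((hasDerivAt_const x (r * a : ℝ)).fun_mul (hasDerivAt_const x (ζ 0))).fun_add ((hasDerivAt_const x (0 : ℝ)).fun_mul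
        (hasDerivAt_const x (ζ 1)))).fun_add ((hasDerivAt_const x (0 : ℝ)).fun_mul (hasDerivAt_const x (ζ 2)))).fun_add
        (((hasDerivAt_const x (r : ℝ)).fun_div (hasDerivAt_Sx x) hS).fun_mul (hasDerivAt_const x (ζ 3)))).congr_deriv (by ring)
  · simp only [F3, F3x, mulVec4, Fin.reduceFinMk, vec4_3]
    exact (((((hasDerivAt_const x (0 : ℝ)).fun_mul (hasDerivAt_const x (ζ 0))).fun_add (((((((hasDerivAt_const x (a ^ 2 :
        ℝ)).fun_mul (hasDerivAt_id' (x := x))).fun_mul (hasDerivAt_Sx x)).fun_mul (hasDerivAt_const x (mu m a r : ℝ))).fun_div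
        (hasDerivAt_Px_x a r x) hP).fun_neg).fun_mul (hasDerivAt_const x (ζ 1)))).fun_add (((((hasDerivAt_const x (r * (r ^ 2 + a
        ^ 2) : ℝ)).fun_mul (hasDerivAt_Sx x)).fun_div (hasDerivAt_Px_x a r x) hP).fun_neg).fun_mul (hasDerivAt_const x (ζ
        2)))).fun_add ((hasDerivAt_const x (0 : ℝ)).fun_mul (hasDerivAt_const x (ζ 3)))).congr_deriv (by ring)

/-- The x-chart Carter quantity `𝒞 = η_θ² + sin⁻²θ(−a sin²θ σ + η_ϕ)² = Sζ_x² + (ζ_ϕ + aSζ_𝔱)²/S` (`η_θ² = sin²θ·ζ_x²`, `σ = −ζ_𝔱`).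
[cite: Hintz2026, display TeX l.5985-5987 (transcription into x = cos θ momenta)] -/
def carterX (a x : ℝ) (ζ : Fin 4 → ℝ) : ℝ := Sx x * ζ 2 ^ 2 + (ζ 3 + a * Sx x * ζ 0) ^ 2 / Sx x

/-- `carterX` IS `CarterTetradFrame.carterC` (the printed `𝒞`) under `s2 = 1 − x²`, `σ = −ζ_𝔱`, `η_θ = −sζ_x` (`s² = 1 − x²`), `η_ϕ = ζ_ϕ`.
[cite: Hintz2026, display TeX l.5985-5987 (reproduced: change of variable)] -/
theorem carterX_eq_carterC (a x s : ℝ) (ζ : Fin 4 → ℝ) (hs : s ^ 2 = 1 - x ^ 2) :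
    carterX a x ζ = carterC a (1 - x ^ 2) (sigmaOf ζ) (-(s * ζ 2)) (ζ 3) := by
  have h2 : (-(s * ζ 2)) ^ 2 = (1 - x ^ 2) * ζ 2 ^ 2 := by rw [neg_sq, mul_pow, hs]
  simp only [carterX, carterC, sigmaOf, Sx, h2]
  ring

/-- The `g_b⁻¹`-pairing of two covectors in the x-chart. [cite: Hintz2026, eq. (6.16a) TeX l.6004-6008 (transcription)] -/
def ginvX (m a r x : ℝ) (u v : Fin 4 → ℝ) : ℝ := ∑ i, ∑ j, u i * gXinv m a r x i j * v j

/-- The four sections as `Fin 4`-indexed family of component vectors: `e⁰ = ζ`, `e^μ = F^μ ζ`. [cite: Hintz2026, frame display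
TeX l.5999-6002 (transcription)] -/
def frameX (m a r x : ℝ) (ζ : Fin 4 → ℝ) : Fin 4 → (Fin 4 → ℝ) :=
  ![ζ, (F1 m a r x).mulVec ζ, (F2 a r x).mulVec ζ, (F3 m a r x).mulVec ζ]

/-- The off-shell correction of the Gram matrix, `CarterTetradFrame.Kmat r c` at `c = a·x` (= `a cos θ`). [cite: Hintz2026, eq.
(6.16a) TeX l.6004-6008 (computed)] -/
theorem Kmat_at (a r x : ℝ) : Kmat r (a * x) =
    !![1, 0, (r ^ 2 + (a * x) ^ 2) / 2, 0; 0, -r ^ 2, 0, -(r * (a * x)); (r ^ 2 + (a * x) ^ 2) / 2, 0,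
      ((r ^ 2 + (a * x) ^ 2) / 2) ^ 2, 0; 0, -(r * (a * x)), 0, -(a * x) ^ 2] := rfl

/-- **(6.16a) `EqWGTrMarckInner` / GII Lemma 3.20 IN THE x-CHART, off shell, for ALL `(𝔪, a)`:**
`g_b⁻¹(e^μ, e^ν) = 𝒞·J_{μν} + G_b·K_{μν}` with `J`, `K` of `CarterTetradFrame` (`c = ax`); hence `= 𝒞·J` on the characteristic set —
an independent check, in coordinates, that `F1, F2, F3` transcribe the printed frame. [cite: Hintz2026, eq. (6.16a)
`EqWGTrMarckInner` TeX l.6004-6008 (reproduced in coordinates); Hintz2024GluingII, Lemma 3.20 TeX l.2921-2939]  -/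
theorem gram_xchart (m a r x : ℝ) (ζ : Fin 4 → ℝ) (hP : Px a r x ≠ 0) (hD : mu m a r ≠ 0) (hS : Sx x ≠ 0) (μ ν : Fin 4) :
    ginvX m a r x (frameX m a r x ζ μ) (frameX m a r x ζ ν) =
      carterX a x ζ * Jmat μ ν + Gb m a r x ζ * Kmat r (a * x) μ ν := by
  fin_cases μ <;> fin_cases ν <;>
    simp only [ginvX, frameX, carterX, Gb, Gfun, Jmat, Kmat_at, F1, F2, F3, gXinv, mulVec4, vec4_0, vec4_1, vec4_2, vec4_3,
        Fin.sum_univ_four, Fin.zero_eta, Fin.mk_one, Fin.reduceFinMk, Matrix.cons_val, Matrix.of_apply, Qsym00, Qsym01, Qsym02,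
        Qsym03, Qsym10, Qsym11, Qsym12, Qsym13, Qsym20, Qsym21, Qsym22, Qsym23, Qsym30, Qsym31, Qsym32, Qsym33, mul_zero,
        zero_mul, add_zero, zero_add, mul_one] <;>
    field_simp <;> (try simp only [Px, mu, Sx]) <;> ring

/-- … so ON the characteristic set the Gram matrix is `𝒞·J` = (6.16a). [cite: Hintz2026, eq. (6.16a) TeX l.6004-6008 (reproduced)] -/
theorem gram_xchart_onshell (m a r x : ℝ) (ζ : Fin 4 → ℝ) (hP : Px a r x ≠ 0) (hD : mu m a r ≠ 0) (hS : Sx x ≠ 0)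
    (hG : Gb m a r x ζ = 0) (μ ν : Fin 4) :
    ginvX m a r x (frameX m a r x ζ μ) (frameX m a r x ζ ν) = carterX a x ζ * Jmat μ ν := by
  rw [gram_xchart m a r x ζ hP hD hS, hG, zero_mul, add_zero]

/-! ## 6. (6.16c) `EqWGTrMarckNabla` = GII Proposition 3.21: the pull-back connection along `H_{G_b}` in the frame, for ALL `(𝔪, a)` -/

/-- **`∇_{H_G} e⁰ = 0` identically** (`e⁰ = ζ`, the tautological section): the geodesic equation in Hamiltonian form — GII: "the covector
`e⁰ = γ̇(s)♭` is parallel along the geodesic `π∘γ`". Holds OFF the characteristic set as well, for all `(𝔪, a)` (`P, μ, S ≠ 0`).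
[cite: Hintz2024GluingII, proof of Prop. 3.21 `PropGlDynTrNabla` TeX l.2954 (reproduced); Hintz2026, (6.16c) TeX l.6014-6018] -/
theorem nabla_e0 (m a r x : ℝ) (ζ : Fin 4 → ℝ) (hP : Px a r x ≠ 0) (hD : mu m a r ≠ 0) (hS : Sx x ≠ 0) (ν : Fin 4) :
    nablaHG m a r x ζ 1 0 0 ν = 0 := by
  have hY := Ymat_eq m a r x ζ hP hD hS
  have hZ := Zvec_eq m a r x ζ hP hD hS
  fin_cases ν <;>
    simp only [nablaHG, HGsec, hY, YC, YCrow0, YCrow1, YCrow2, YCrow3, hZ, ZC, dGr, dGx, Gfun, gXinvr, gXinvx, Matrix.one_mulVec,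
        Matrix.zero_mulVec, Pi.zero_apply, Matrix.one_apply, Fin.sum_univ_four, Fin.zero_eta, Fin.mk_one, Fin.reduceFinMk,
        Matrix.cons_val, Matrix.of_apply, reduceIte, Fin.reduceEq, Qsym00, Qsym01, Qsym02, Qsym03, Qsym10, Qsym11, Qsym12, Qsym13,
        Qsym20, Qsym21, Qsym22, Qsym23, Qsym30, Qsym31, Qsym32, Qsym33, mul_zero, zero_mul, add_zero, zero_add, sub_zero,
        zero_sub, mul_one] <;>
    field_simp <;> (try simp only [Px, mu, Sx]) <;> ring

/-- **`∇_{H_G} e³ = 0` identically** (`e³ = KY(ζ)`): GII "By the properties of `KY`, also `e³` … [is] parallel" — here by direct computation,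
OFF the characteristic set as well, for all `(𝔪, a)`. [cite: Hintz2024GluingII, proof of Prop. 3.21 TeX l.2954 (reproduced);
Hintz2026, (6.16c) TeX l.6014-6018] -/
theorem nabla_e3 (m a r x : ℝ) (ζ : Fin 4 → ℝ) (hP : Px a r x ≠ 0) (hD : mu m a r ≠ 0) (hS : Sx x ≠ 0) (ν : Fin 4) :
    nablaHG m a r x ζ (F3 m a r x) (F3r m a r x) (F3x m a r x) ν = 0 := by
  have hY := Ymat_eq m a r x ζ hP hD hS
  have hZ := Zvec_eq m a r x ζ hP hD hS
  fin_cases ν <;>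
    simp only [nablaHG, HGsec, hY, YC, YCrow0, YCrow1, YCrow2, YCrow3, hZ, ZC, dGr, dGx, Gfun, gXinvr, gXinvx, F3, F3r, F3x,
        mulVec4, vec4_0, vec4_1, vec4_2, vec4_3, Fin.sum_univ_four, Fin.zero_eta, Fin.mk_one, Fin.reduceFinMk, Matrix.cons_val,
        Matrix.of_apply, Qsym00, Qsym01, Qsym02, Qsym03, Qsym10, Qsym11, Qsym12, Qsym13, Qsym20, Qsym21, Qsym22, Qsym23, Qsym30,
        Qsym31, Qsym32, Qsym33, mul_zero, zero_mul, add_zero, zero_add, sub_zero] <;>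
    field_simp <;> (try simp only [Px, mu, Sx]) <;> ring

/-- The defect of (6.16c) for `e¹` off shell: `q₁ = −2(∂_𝔱)♭ = (−2g_{𝔱𝔱}, 0, 0, −2g_{𝔱ϕ})`. [cite: Hintz2026, (6.16c) TeX l.6014-6018 (computed)] -/
def q1 (m a r x : ℝ) : Fin 4 → ℝ := ![-(2 * gX m a r x 0 0), 0, 0, -(2 * gX m a r x 0 3)]

/-- **`∇_{H_G} e¹ = −2σ·e⁰ − 2G_b·(∂_𝔱)♭`** for ALL `(𝔪, a)` (`P, μ, S ≠ 0`), `σ = −ζ_𝔱`: on the characteristic set `∇_{H_G}e¹ = α₀e⁰` with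
**`α₀ = −2σ`**.  GII Prop. 3.21 / H (6.16c) print `α₀ = +2σ` ("A lengthy direct computation gives `α₀ = 2σ`", GII l.2960) — audit datum
SRC-A16 (cell, two CAS engines, now the kernel): with `H_G` and `σ` exactly as printed the coefficient is `−2σ = 2ζ_𝔱 = 2⟨ζ, ∂_𝔱⟩`; the size
`|α₀| = 2|σ|`, which is all that Lemma 6.4 / Prop. 8.3 use, is as printed. [cite: Hintz2024GluingII, Prop. 3.21
`PropGlDynTrNabla` TeX l.2941-2963 (reproduced up to the sign datum SRC-A16); Hintz2026, eq. (6.16c) `EqWGTrMarckNabla` TeX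
l.6014-6018] -/
theorem nabla_e1 (m a r x : ℝ) (ζ : Fin 4 → ℝ) (hP : Px a r x ≠ 0) (hD : mu m a r ≠ 0) (hS : Sx x ≠ 0) (ν : Fin 4) :
    nablaHG m a r x ζ (F1 m a r x) (F1r m a r x) (F1x m a r x) ν =
      -(2 * sigmaOf ζ) * ζ ν + Gb m a r x ζ * q1 m a r x ν := by
  have hY := Ymat_eq m a r x ζ hP hD hS
  have hZ := Zvec_eq m a r x ζ hP hD hS
  fin_cases ν <;>
    simp only [nablaHG, HGsec, hY, YC, YCrow0, YCrow1, YCrow2, YCrow3, hZ, ZC, dGr, dGx, Gfun, gXinvr, gXinvx, F1, F1r, F1x,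
        mulVec4, vec4_0, vec4_1, vec4_2, vec4_3, sigmaOf, Gb, q1, gX, gXinv, Fin.sum_univ_four, Fin.zero_eta, Fin.mk_one,
        Fin.reduceFinMk, Matrix.cons_val, Matrix.of_apply, Qsym00, Qsym01, Qsym02, Qsym03, Qsym10, Qsym11, Qsym12, Qsym13, Qsym20,
        Qsym21, Qsym22, Qsym23, Qsym30, Qsym31, Qsym32, Qsym33, mul_zero, zero_mul, add_zero, zero_add, sub_zero] <;>
    field_simp <;> (try simp only [Px, mu, Sx]) <;> ring

/-- The defect of (6.16c) for `e²` off shell: `q₂ = 2r dr − 2a²x dx`. [cite: Hintz2026, (6.16c) TeX l.6014-6018 (computed)] -/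
def q2 (a r x : ℝ) : Fin 4 → ℝ := ![0, 2 * r, -(2 * a ^ 2 * x), 0]

/-- **`∇_{H_G} e² = −2σ·e¹ + G_b·(2r dr − 2a²x dx)`** for ALL `(𝔪, a)`: on the characteristic set `∇_{H_G}e² = β₁e¹`, **`β₁ = α₀ = −2σ`**
(GII: "`β₁ = … = α₀`"; sign datum SRC-A16 as for `e¹`). [cite: Hintz2024GluingII, Prop. 3.21 TeX l.2941-2963 (reproduced up to
SRC-A16); Hintz2026, eq. (6.16c) TeX l.6014-6018] -/
theorem nabla_e2 (m a r x : ℝ) (ζ : Fin 4 → ℝ) (hP : Px a r x ≠ 0) (hD : mu m a r ≠ 0) (hS : Sx x ≠ 0) (ν : Fin 4) :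
    nablaHG m a r x ζ (F2 a r x) (F2r a r x) (F2x a r x) ν =
      -(2 * sigmaOf ζ) * (F1 m a r x).mulVec ζ ν + Gb m a r x ζ * q2 a r x ν := by
  have hY := Ymat_eq m a r x ζ hP hD hS
  have hZ := Zvec_eq m a r x ζ hP hD hS
  fin_cases ν <;>
    simp only [nablaHG, HGsec, hY, YC, YCrow0, YCrow1, YCrow2, YCrow3, hZ, ZC, dGr, dGx, Gfun, gXinvr, gXinvx, F2, F2r, F2x, F1,
        mulVec4, vec4_0, vec4_1, vec4_2, vec4_3, sigmaOf, Gb, q2, gXinv, Fin.sum_univ_four, Fin.zero_eta, Fin.mk_one,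
        Fin.reduceFinMk, Matrix.cons_val, Matrix.of_apply, Qsym00, Qsym01, Qsym02, Qsym03, Qsym10, Qsym11, Qsym12, Qsym13, Qsym20,
        Qsym21, Qsym22, Qsym23, Qsym30, Qsym31, Qsym32, Qsym33, mul_zero, zero_mul, add_zero, zero_add, sub_zero] <;>
    field_simp <;> (try simp only [Px, mu, Sx]) <;> ring

/-- **(6.16c) on the characteristic set, all four columns**: at `G_b(ζ) = 0`,
`∇_{H_G}(e⁰, e¹, e², e³) = (0, −2σe⁰, −2σe¹, 0)`, i.e. `∇_{H_G}e^μ = Σ_ν (−2σ)N_{νμ} e^ν` with the printed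
`N = [[0,1,0,0],[0,0,1,0],[0,0,0,0],[0,0,0,0]]` (`CarterTetradFrame.Nmat`); as an operator on coefficient vectors `u ↦ Σu_μe^μ` this is
`∇^{π*T*}_{H_G} = H_G − 2σN` (printed: `+ 2σN`, SRC-A16).  The same matrix in the normalised frame `𝖾^μ = 𝒞^{-1/2}e^μ` of (6.16b),
because `H_G𝒞 = 0` on the characteristic set (`HG_carterX_onshell`). [cite: Hintz2026, eq. (6.16c) `EqWGTrMarckNabla` TeX
l.6009-6019 (reproduced up to SRC-A16); Hintz2024GluingII, Prop. 3.21 TeX l.2941-2963] -/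
theorem eq616c_onshell (m a r x : ℝ) (ζ : Fin 4 → ℝ) (hP : Px a r x ≠ 0) (hD : mu m a r ≠ 0) (hS : Sx x ≠ 0)
    (hG : Gb m a r x ζ = 0) (ν : Fin 4) :
    nablaHG m a r x ζ 1 0 0 ν = 0 ∧
      nablaHG m a r x ζ (F1 m a r x) (F1r m a r x) (F1x m a r x) ν = -(2 * sigmaOf ζ) * ζ ν ∧
      nablaHG m a r x ζ (F2 a r x) (F2r a r x) (F2x a r x) ν = -(2 * sigmaOf ζ) * (F1 m a r x).mulVec ζ ν ∧
      nablaHG m a r x ζ (F3 m a r x) (F3r m a r x) (F3x m a r x) ν = 0 := by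
  refine ⟨nabla_e0 m a r x ζ hP hD hS ν, ?_, ?_, nabla_e3 m a r x ζ hP hD hS ν⟩
  · rw [nabla_e1 m a r x ζ hP hD hS, hG, zero_mul, add_zero]
  · rw [nabla_e2 m a r x ζ hP hD hS, hG, zero_mul, add_zero]

/-- The frame-coefficient form: with `frameX = (e⁰,e¹,e²,e³)`, on the characteristic set `∇_{H_G}e^μ = Σ_κ (−2σ·N_{κμ})·e^κ`
for `μ = 1, 2` and `= 0` for `μ = 0, 3` — the transpose bookkeeping behind "`∇ = H_G + (coefficient)·N`". [cite: Hintz2026, eq.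
(6.16c) TeX l.6014-6018 (reproduced up to SRC-A16)] -/
theorem eq616c_frame_form (m a r x : ℝ) (ζ : Fin 4 → ℝ) (hP : Px a r x ≠ 0) (hD : mu m a r ≠ 0) (hS : Sx x ≠ 0)
    (hG : Gb m a r x ζ = 0) (ν : Fin 4) :
    nablaHG m a r x ζ (F1 m a r x) (F1r m a r x) (F1x m a r x) ν =
        ∑ κ, (-(2 * sigmaOf ζ) * Nmat κ 1) * frameX m a r x ζ κ ν ∧
      nablaHG m a r x ζ (F2 a r x) (F2r a r x) (F2x a r x) ν =
        ∑ κ, (-(2 * sigmaOf ζ) * Nmat κ 2) * frameX m a r x ζ κ ν := by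
  obtain ⟨_, h1, h2, _⟩ := eq616c_onshell m a r x ζ hP hD hS hG ν
  constructor
  · rw [h1]; simp [Nmat, frameX, Fin.sum_univ_four]
  · rw [h2]; simp [Nmat, frameX, Fin.sum_univ_four]

/-- **SRC-A16 decided in the kernel**: if at some null covector the PRINTED column held, `∇_{H_G}e¹ = +2σe⁰`, then `σ·ζ = 0` there —
impossible on `Γ₀`, where `σ > 0` (H l.7498: "positive on $\Gamma_0$ (since $\sigma>0$ there by [AF,
(EqTs3bOTrapSign)])") and `ζ ≠ 0`.  So, with `H_G` and `σ` as printed, the sign of the nilpotent block is `−`.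
[cite: Hintz2026, eq. (6.16c) TeX l.6014-6018 (audit datum SRC-A16, computed); Hintz2024GluingII, TeX l.2960] -/
theorem src_A16 (m a r x : ℝ) (ζ : Fin 4 → ℝ) (hP : Px a r x ≠ 0) (hD : mu m a r ≠ 0) (hS : Sx x ≠ 0)
    (hG : Gb m a r x ζ = 0) (ν : Fin 4)
    (hprinted : nablaHG m a r x ζ (F1 m a r x) (F1r m a r x) (F1x m a r x) ν = 2 * sigmaOf ζ * ζ ν) :
    sigmaOf ζ * ζ ν = 0 := by
  have h := (eq616c_onshell m a r x ζ hP hD hS hG ν).2.1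
  rw [hprinted] at h
  linarith

/-! ## 7. Carter's constant is conserved along the null bicharacteristic flow (H l.5988, GII l.2886) -/

/-- `∂_x 𝒞` in quotient-rule form (certified: `hasDerivAt_carterX_x`). [cite: Hintz2026, TeX l.5985-5988 (computed)] -/
def carterXx (a x : ℝ) (ζ : Fin 4 → ℝ) : ℝ :=
  -(2 * x) * ζ 2 ^ 2 + (2 * (ζ 3 + a * Sx x * ζ 0) * (a * -(2 * x) * ζ 0) * Sx x - (ζ 3 + a * Sx x * ζ 0) ^ 2 * -(2 * x)) / Sx x ^
      2

/-- `∂𝒞/∂ζ_k` in product-rule form (certified: `hasDerivAt_carterX_mom`). [cite: Hintz2026, TeX l.5985-5988 (computed)] -/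
def carterXmom (a x : ℝ) (ζ : Fin 4 → ℝ) : Fin 4 → ℝ :=
  ![2 * (ζ 3 + a * Sx x * ζ 0) * (a * Sx x) * Sx x / Sx x ^ 2, 0, Sx x * (2 * ζ 2), 2 * (ζ 3 + a * Sx x * ζ 0) * Sx x / Sx x ^ 2]

/-- **`∂_x 𝒞` certified** (`𝒞` does not depend on `r`). [cite: Hintz2026, TeX l.5985-5988 (computed)] -/
theorem hasDerivAt_carterX_x (a x : ℝ) (ζ : Fin 4 → ℝ) (hS : Sx x ≠ 0) :
    HasDerivAt (fun x' => carterX a x' ζ) (carterXx a x ζ) x := by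
  unfold carterX carterXx
  exact (((hasDerivAt_Sx x).fun_mul (hasDerivAt_const x (ζ 2 ^ 2))).fun_add
    ((((hasDerivAt_const x (ζ 3)).fun_add (((hasDerivAt_const x a).fun_mul (hasDerivAt_Sx x)).fun_mul
      (hasDerivAt_const x (ζ 0)))).fun_pow 2).fun_div (hasDerivAt_Sx x) hS)).congr_deriv (by ring)

/-- **`∂𝒞/∂ζ_k` certified.** [cite: Hintz2026, TeX l.5985-5988 (computed)] -/
theorem hasDerivAt_carterX_mom (a x : ℝ) (ζ : Fin 4 → ℝ) (hS : Sx x ≠ 0) (k : Fin 4) :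
    HasDerivAt (fun t => carterX a x (Function.update ζ k t)) (carterXmom a x ζ k) (ζ k) := by
  fin_cases k
  · simp only [carterX, carterXmom, Fin.isValue, Function.update_self, ne_eq, Fin.reduceEq, not_false_eq_true,
      Function.update_of_ne, Fin.zero_eta, vec4_0]
    exact ((hasDerivAt_const (ζ 0) (Sx x * ζ 2 ^ 2)).fun_add ((((hasDerivAt_const (ζ 0) (ζ 3)).fun_add
      ((hasDerivAt_const (ζ 0) (a * Sx x)).fun_mul (hasDerivAt_id' (x := ζ 0)))).fun_pow 2).fun_div
      (hasDerivAt_const (ζ 0) (Sx x)) hS)).congr_deriv (by ring)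
  · simp only [carterX, carterXmom, Fin.isValue, ne_eq, Fin.reduceEq, not_false_eq_true, Function.update_of_ne,
      Fin.mk_one, vec4_1]
    exact (hasDerivAt_const (ζ 1) (Sx x * ζ 2 ^ 2 + (ζ 3 + a * Sx x * ζ 0) ^ 2 / Sx x)).congr_deriv (by ring)
  · simp only [carterX, carterXmom, Fin.isValue, Function.update_self, ne_eq, Fin.reduceEq, not_false_eq_true,
      Function.update_of_ne, Fin.reduceFinMk, vec4_2]
    exact (((hasDerivAt_const (ζ 2) (Sx x)).fun_mul ((hasDerivAt_id' (x := ζ 2)).fun_pow 2)).fun_add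
      (hasDerivAt_const (ζ 2) ((ζ 3 + a * Sx x * ζ 0) ^ 2 / Sx x))).congr_deriv (by ring)
  · simp only [carterX, carterXmom, Fin.isValue, Function.update_self, ne_eq, Fin.reduceEq, not_false_eq_true,
      Function.update_of_ne, Fin.reduceFinMk, vec4_3]
    exact ((hasDerivAt_const (ζ 3) (Sx x * ζ 2 ^ 2)).fun_add ((((hasDerivAt_id' (x := ζ 3)).fun_add
      (hasDerivAt_const (ζ 3) (a * Sx x * ζ 0))).fun_pow 2).fun_div (hasDerivAt_const (ζ 3) (Sx x)) hS)).congr_deriv (by ring)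

/-- `H_G` on a scalar phase-space function `f(r, x, ζ)` with certified partials `fr = ∂_r f`, `fx = ∂_x f`, `fζ = ∂f/∂ζ`:
`H_G f = Z^r fr + Z^x fx − (∂_rG) fζ_r − (∂_xG) fζ_x` (`∂_𝔱G = ∂_ϕG = 0`). [cite: Hintz2024GluingII, Hamiltonian vector field
convention TeX l.2679-2681 (transcription)] -/
def HGfun (m a r x : ℝ) (ζ : Fin 4 → ℝ) (fr fx : ℝ) (fζ : Fin 4 → ℝ) : ℝ :=
  Zvec m a r x ζ 1 * fr + Zvec m a r x ζ 2 * fx - (dGr m a r x ζ * fζ 1 + dGx m a r x ζ * fζ 2)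

/-- `H_G G = 0` (any function Poisson-commutes with itself): with `G`'s own certified partials. [folklore] -/
theorem HGfun_G (m a r x : ℝ) (ζ : Fin 4 → ℝ) :
    HGfun m a r x ζ (dGr m a r x ζ) (dGx m a r x ζ) (Zvec m a r x ζ) = 0 := by
  unfold HGfun; ring

/-- **`H_{G_b}𝒞 = a²·G_b·H_{G_b}(x²)`, `H_{G_b}(x²) = 2x·Z^x`**, for ALL `(𝔪, a)`: OFF the characteristic set `𝒞` is NOT conserved
(the conserved quantity is Carter's `K = 𝒞 − a²cos²θ·G_b`, GII l.2884-2886), ON it `H_G𝒞 = 0` — exactly Hintz's "conserved along the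
Hamiltonian flow of `G_b` in the characteristic set `G_b⁻¹(0)`" (H l.5988). [cite: Hintz2026, TeX l.5988 (reproduced);
Hintz2024GluingII, TeX l.2883-2890 (reproduced); Carter1968, §4] -/
theorem HG_carterX (m a r x : ℝ) (ζ : Fin 4 → ℝ) (hP : Px a r x ≠ 0) (hD : mu m a r ≠ 0) (hS : Sx x ≠ 0) :
    HGfun m a r x ζ 0 (carterXx a x ζ) (carterXmom a x ζ) = a ^ 2 * Gb m a r x ζ * (2 * x * Zvec m a r x ζ 2) := by
  have hZ := Zvec_eq m a r x ζ hP hD hS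
  simp only [HGfun, carterXx, carterXmom, hZ, ZC, dGr, dGx, Gfun, gXinvr, gXinvx, Gb, gXinv, vec4_1, vec4_2, Fin.sum_univ_four,
      Qsym00, Qsym01, Qsym02, Qsym03, Qsym10, Qsym11, Qsym12, Qsym13, Qsym20, Qsym21, Qsym22, Qsym23, Qsym30, Qsym31, Qsym32,
      Qsym33, mul_zero, zero_mul, add_zero, zero_add]
  field_simp
  simp only [Px, mu, Sx]
  ring

/-- … hence **`H_{G_b}𝒞 = 0` on the characteristic set**. [cite: Hintz2026, TeX l.5988 (reproduced); Carter1968, §4] -/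
theorem HG_carterX_onshell (m a r x : ℝ) (ζ : Fin 4 → ℝ) (hP : Px a r x ≠ 0) (hD : mu m a r ≠ 0) (hS : Sx x ≠ 0)
    (hG : Gb m a r x ζ = 0) : HGfun m a r x ζ 0 (carterXx a x ζ) (carterXmom a x ζ) = 0 := by
  rw [HG_carterX m a r x ζ hP hD hS, hG]; ring

/-! ## 8. The Schwarzschild trapped set (GII Remark 3.22): `a = 0`, `r = 3𝔪`, `ξ = 0` -/

/-- **GII Remark 3.22 reproduced, with one sign corrected**: at `a = 0`, `r = 3𝔪`, `ξ = 0` (covectors `−σ d𝔱 + η`, `η = ζ_x dx + ζ_ϕ dϕ`):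
`e¹ = −9𝔪σ dr` (as printed), `e² = −(9𝔪²/2)(σ d𝔱 + η)` (printed: `+(9𝔪²/2)(σ d𝔱 + η)` — with the printed sign `g⁻¹(e⁰,e²)` would be `+𝒞`,
contradicting Lemma 3.20's `−𝒞`; audit datum EXT-G13, print-level, GII is an input preprint), `e³ = 3𝔪(ζ_ϕ S⁻¹ dx − Sζ_x dϕ)`
`= 3𝔪·⋆η` for `⋆dθ = sinθ dϕ`, `⋆dϕ = −dθ/sinθ` (as printed). [cite: Hintz2024GluingII, Remark 3.22 `RmkGlDynTrSchw` TeX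
l.2967-2977 (reproduced; e² sign datum)] -/
theorem schwarzschild_trapped_frame (m x : ℝ) (ζ : Fin 4 → ℝ) (hm : m ≠ 0) (hξ : ζ 1 = 0) :
    (F1 m 0 (3 * m) x).mulVec ζ = ![0, -(9 * m) * sigmaOf ζ, 0, 0] ∧
      (F2 0 (3 * m) x).mulVec ζ = ![-(9 * m ^ 2 / 2) * sigmaOf ζ, 0, -(9 * m ^ 2 / 2) * ζ 2, -(9 * m ^ 2 / 2) * ζ 3] ∧
      (F3 m 0 (3 * m) x).mulVec ζ = ![0, 0, 3 * m * (ζ 3 / Sx x), -(3 * m * (Sx x * ζ 2))] := by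
  have hμ : mu m 0 (3 * m) = 3 * m ^ 2 := by simp only [mu]; ring
  have hP : Px 0 (3 * m) x = 9 * m ^ 2 := by simp only [Px]; ring
  refine ⟨?_, ?_, ?_⟩ <;> (ext i; fin_cases i <;> simp only [F1, F2, F3, mulVec4, vec4_0, vec4_1, vec4_2, vec4_3, sigmaOf, hξ, hμ,
      hP, Fin.zero_eta, Fin.mk_one, Fin.reduceFinMk, mul_zero, zero_mul, add_zero, zero_add, neg_zero] <;> field_simp <;> ring)

end Literature.Geometry.Lorentzian.Hintz2026.MarckFrameConnection

end
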